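import Summits.AtomisticToContinuum.FouriersLaw.Theses.PhononMeanFreePath
import Literature.Barriers.AtomisticToContinuum.LowTemperatureWeakAnharmonicity
import Literature.MathematicalPhysics.KineticTheory.HarmonicChainNESS
import Literature.MathematicalPhysics.KineticTheory.LangevinChainDynkin
import Literature.MathematicalPhysics.KineticTheory.ChainControl
import Summits.AtomisticToContinuum.FouriersLaw.Theorems.PhononMeanFreePathDefs
import Summits.AtomisticToContinuum.FouriersLaw.Theorems.IncoherentChannel.Negative.HarmonicWick
import Summits.AtomisticToContinuum.FouriersLaw.Theorems.BondHeatUncertaintySubdiffusiveBondHeatKernelGibbsD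
import Summits.AtomisticToContinuum.FouriersLaw.Theorems.PhononMeanFreePathIncoherentChannelCommonPastBoundHelper2
import Summits.AtomisticToContinuum.FouriersLaw.Theorems.PhononMeanFreePathIncoherentChannelLightConeReduction
import Summits.AtomisticToContinuum.FouriersLaw.Theorems.PhononMeanFreePathIncoherentChannelTwoHorizonsCrux
import Summits.AtomisticToContinuum.FouriersLaw.Theorems.PhononMeanFreePathKuboFormFouriersLaw

/-!
# Disproof of `IncoherentChannel` — standing-adversary work file (cdisprove; gen 1 cycles 1–2, gen 2 cycle 1 (lost), gen 3 cycle 1)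

Crux (item `stmt-AtomisticToContinuum-11811`, decl
`Summit.AtomisticToContinuum.FouriersLaw.Theses.PhononMeanFreePath.IncoherentChannel`, rank 3,
route `PhononMeanFreePath`):

  `∀ ω₂ lam β γ > 0, ∀ T > 0, ∃ κ > 0, a_N → κ`,
  `a_N := N · (γ²/T²) · ∫_{t>0} [C_N(t) - 2 r_N(t)²] dt`,

with `r_N(t) = ∫ p₀ · (K_t p_N) dμ₀`, `C_N(t) = ∫ p₀² (K_t p_N²) dμ₀ - (∫ p₀² dμ₀)(∫ K_t p_N² dμ₀)`,
`μ₀ = gibbsMeasure (N+1) T`, `K_t = transitionKernel (N+1) T T t` of `pinnedChain ω₂ lam β γ`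
(both CONSTRUCTED in Literature: tilted Lebesgue measure / law of the pathwise SDE flow).

## VERDICT so far: NO KILL — a proof that no CHEAP kill exists (§3), and the harmonic corner is now
## an UNCONDITIONAL counter-model of the crux-without-anharmonicity (§5, Wick identity PROVED)

Everything below is sorry-free (rc 0, axioms propext/Classical.choice/Quot.sound); §1–§3 landed as
`Theorems/IncoherentChannel/Negative/LoadBearing.lean` (p72682 ACCEPTED), §4 as
`…/Negative/UnitTemperature.lean` (p74342), §5 as `…/Negative/{HarmonicFlow, KernelMoments, GibbsStein,
HarmonicWick}.lean` (p75554, p76001, p76785, p77793 — all ACCEPTED); §6 (gen 3) as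
`…/Negative/{ForecastLossGammaZero, VarianceLimitHarmonic, LineScaling, LineResistance}.lean` (this cycle).

* §0 `incoherentChannel_iff` — the crux is `At ω₂ lam β γ T` (`∃ κ > 0, a_N → κ`) pointwise, `Iff.rfl`.
* §1 STRUCTURE. `At` ⇒ `a_N > 0` eventually ⇒ `∫_{t>0}(C_N - 2r_N²) > 0` eventually (a SIGN
  prediction: the time-integrated connected 4-point function of the two bath momenta is eventually
  POSITIVE) ⇒ `t ↦ C_N - 2r_N²` is INTEGRABLE on `(0,∞)` for all large `N` (hidden fixed-`N` mixing
  content; the statement cannot be junk-true; contrapositive `not_At_of_frequently_not_integrableOn`).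
* §2 LOAD-BEARING. `γ = 0` and `T = 0` admitted ⇒ FALSE (prefactor `γ²/T²` vanishes / is junk);
  harmonic corner `lam = β = 0` admitted ⇒ FALSE (`cruxWithoutAnharmonicity_false`, UNCONDITIONAL
  since §5: the Wick identity `C_N ≡ 2r_N²` is PROVED for the constructed kernels — the cumulant
  channel of the Gaussian chain is EMPTY, `a_N ≡ 0`). `0 < ω₂`: NOT load-bearing in substance (pure
  quartic pinning still pins; the tree even constructs those kernels, `PureQuarticKernel*`), only
  the flow API used here assumes it.
* §3 WHY IT RESISTS. `incoherentChannel_iff_fouriersLaw`: under the sibling items `NessUnique`,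
  `BoundaryKubo`, `CoherentDephasing` the crux is EQUIVALENT to the sub-problem conjunct `FouriersLaw`
  (the converse of the route's `closes`, proved here). So with the siblings standing, refuting the
  crux = refuting Fourier's law for the pinned anharmonic chain (BLR 2000's open problem; no printed
  negative result; numerics normal) — there is no statement-level slack to exploit: quantifier order
  (`κ` before `N`) is right, `κ` may depend on `γ` (weaker than physics, harmless), indexing `N` bonds /
  `N+1` sites gives `N·G_{N+1} → κ` under any finite contact resistance.
* §4 NORMAL FORM. The amplitude scaling `(q,p) ↦ (sq,sp)` is pushed through the CONSTRUCTED flow,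
  solution map, transition kernels and Gibbs integrals (`chainFlow_smul`, `transitionKernel_smul`,
  `integral_gibbsMeasure_smul`): `r_N ↦ s²r_N`, `C_N ↦ s⁴C_N`, and `a_N(lam,β,s²T) = a_N(lam s²,β s²,T)`
  EXACTLY (`seqA_smul`); hence `At ω₂ lam β γ T ↔ At ω₂ (lam·T) (β·T) γ 1` and
  `incoherentChannel_iff_unit_temperature`: the crux is its `T = 1` slice. Temperature is not an
  independent parameter; `T → 0` IS the harmonic corner of §2.
* §5 THE HARMONIC CORNER, PROVED (`harmonicWick_holds`, `not_At_harmonic`): superposition for the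
  constructed pathwise flow (`harmonic_chainFlow_add/_smul`, `M_t` linear,
  `harmonic_transitionKernel_eq_map`: the kernel from `x` is the kernel from rest translated by
  `M_t x`), CEHR (3.4) ⇒ `p_i, p_i²` kernel-integrable, hence `P_t p_N = (M_t x)_N + m_t`,
  `P_t p_N² = (M_t x)_N² + 2m_t(M_t x)_N + w_t`; on the Gibbs side, reflection symmetry (odd moments
  vanish, from §4 with `s = -1`), polynomial-growth integrability, and STEIN'S IDENTITY in the `p_i`
  direction `∫ p_i F dμ_T = T ∫ ∂_{p_i}F dμ_T` (momenta exactly Gaussian — for EVERY chain of the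
  family, anharmonic included: `gibbs_sq_momentum` equipartition, `gibbs_momentum_mul_clm`,
  `gibbs_sq_momentum_mul_clm_sq` = the Wick pair identity `∫p_i²L² = T∫L² + 2(∫p_iL)²` for linear `L`).
  With `L = p_N ∘ M_t` this is `C_N = 2r_N²`. By-product for item 11814 (HarmonicCoherentPersistence):
  the OU structure of `transitionKernel` at `lam = β = 0` is now available without stochastic calculus.
* NUMERICS (kit; `num/md_channels.py`: BAOAB equilibrium MD of the open chain, exact Gibbs sampling by
  an all-site thermostat then end baths only; `r_N`, `C_N` by FFT cross-correlation over replicas ×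
  time origins, delete-one-chunk jackknife; running time-integrals with cutoff `t_c`; NEMD at
  `T ± 0.1`, conductance `G = J/δT`; evidence `compute-<job>.json` + `channels.json` on the item).
  (a) HARMONIC CONTROL j013804 (`lam = β = 0`, ω₂ = γ = T = 1, R = 4096, N = 1,2,4,8): the typed
      normalisation is EXACT against NEMD in the solvable corner — coherent channel per bond
      `2(γ²/T²)∫r_N²` vs `J/δT`: 0.1676/0.1658, 0.1358/0.1370, 0.1249/0.1267, 0.1247/0.1230 (1–1.5%),
      ballistic plateau `G → 0.123` with the flat Rieder–Lebowitz–Lieb profile (1.074, 1.006, …, 0.992,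
      0.925), coherent part `N·G` linear in `N` (0.27, 0.50, 1.00: HarmonicCoherentPersistence ✓); and
      the §5 THEOREM numerically: `∫₀^{t_c}(C_N − 2r_N²)` consistent with 0 wherever resolved
      (N=8: −0.001±0.002 at t_c=10, −0.0003±0.0034 at t_c=20; all N, t_c ≤ 20: |·| ≤ 0.004±0.004).
  (b) ANHARMONIC j013815 (ω₂ = lam = β = γ = T = 1, R = 3072, N = 1,2,4,8): BoundaryKubo's cross-form
      identity WITH ITS CONSTANT `N·γ²/T²` confirmed against NEMD — `N(γ²/T²)∫₀^{t_c}C_N` vs `N·J/δT`: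
      N=1: 0.248±0.004 / 0.247±0.003; N=2: 0.419±0.010 / 0.418±0.004; N=4: 0.76–0.79±0.03 / 0.773±0.013;
      N=8: 1.53±0.07 (t_c=40) / 1.516±0.021. COHERENT channel `2(γ²/T²)N∫r_N²` = 0.213, 0.310, 0.402,
      0.356 — peaks near N ≈ 4–6 and DECAYS (per bond 0.213, 0.155, 0.100, 0.0445: thermal mean free
      path ≈ 4–6 sites; CoherentDephasing's mechanism visible). INCOHERENT channel (the crux's `a_N`,
      t_c = 40): +0.035±0.002, +0.110±0.010, +0.36±0.02, +1.17±0.07 — POSITIVE (§1 sign prediction ✓),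
      increasing, 77% of the total at N=8. `N·G_NEMD` = 0.247, 0.418, 0.773, 1.516 is still in the
      contact-dominated crossover (G: 0.247 → 0.189; N=8 profile: Kapitza jumps 0.06 at each end, bulk
      gradient 0.024 over 7 bonds ⇒ bulk κ(1) ≈ 10, saturation only for N ≳ 50). Nothing anomalous at
      any resolved (N, t_c). TWO-CHANNEL BOOKKEEPING CLOSES: the directly measured 4-point channel equals
      `N·G_NEMD − coherent` — N=1: 0.035 vs 0.034; N=2: 0.110 vs 0.108; N=4: 0.36–0.38 vs 0.371;
      N=8: 1.17±0.07 vs 1.160.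
  (c) WEAKER ANHARMONICITY j013816 (lam = β = 1/4, rest as (b); N = 1,2,4,8): Kubo/NEMD 0.203/0.203,
      0.331/0.334, 0.61–0.62/0.612, 1.15±0.07/1.221; coherent `2(γ²/T²)N∫r_N²` = 0.192, 0.301, 0.482,
      0.69 still RISING at N=8 (per bond 0.192, 0.150, 0.120, 0.086 — slower decay than (b)'s
      0.213 → 0.0445: longer mean free path at weaker coupling, as `ℓ ∝ (lam·T)⁻²` predicts); incoherent
      `a_N` = +0.011, +0.030, +0.13, +0.39–0.47 (positive, growing; 38% of the total at N=8 vs 77% in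
      (b)). Everything matches the two-channel picture; no sign anomaly anywhere. N = 16, 32 runs
      (j014476–9) pending.

* §6 (GEN 3, cycle 1 — THE LIVE LINE `two-horizons-forecast-loss`, lead c1; gen-2's §6 was written while the farm
  was down and never reached the tree or the ledger — re-derived and extended here). Over the landed route
  vocabulary `PhononMeanFreePathDefs` (`fcast, fnorm, pairCorr = rN, commonPast, powerCov = CN, varianceChannel`);
  the line's two OPEN stubs are the engine `stub_forecastLoss` (`∃ C α>2 ∀ N t≥0, S_N(t) ≤ C(1+t)^(-α)`) and the
  transport core `stub_varianceLimit` (`∃ κ>0, N(γ²/T²)∫B_N → κ`); joint sufficiency is kernel-certified by the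
  lead (`incoherentChannel_of_forecastLoss_of_varianceLimit`), so only the stubs themselves are targets.
  (6.1) `0 < γ` IS LOAD-BEARING FOR THE ENGINE: at `γ = 0` the constructed kernel is the Dirac mass at the
      deterministic flow (`transitionKernel_gamma_zero`), the forecast is exact and `S_N(t) = T` for all `N, t`
      (`fnorm_gamma_zero`, Gibbs invariance holds at `γ ≥ 0`) ⇒ `forecastLossWithoutGammaPos_false`.
  (6.2) THE TRANSPORT CORE IS EMPTY AT THE HARMONIC CORNER (Kalman): `K_t p_N² − (K_t p_N)²` is constant in the
      initial state (`harmonic_condVar_eq_const`), `B_N ≡ 0` (`varianceChannel_harmonic_eq_zero`),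
      `varianceLimit_false_harmonic`, `varianceLimitWithoutAnharmonicity_false`; and `P_N = C_N`, `P_N − 2r_N² ≡ 0`
      there (`meanChannel_integrand_harmonic_eq_zero`): the crux's whole harmonic obstruction sits in stub 4′, the
      engine's harmonic failure (lead's `forecastLossEnvelope_false_harmonic`) is a separate, coherent-channel fact.
  (6.3) UNIT-TEMPERATURE NORMAL FORM OF BOTH STUBS: `v_t ↦ s v_t`, `S_N ↦ s²S_N`, `r_N ↦ s²r_N`,
      `C_N, P_N, B_N ↦ s⁴(…)`, transport sequence invariant (`fnorm_smul … varianceSeq_smul`);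
      `S_N(t; lam,β,T) = T·S_N(t; lamT,βT,1)` (`fnorm_eq_effective`); `forecastLoss_iff_unit_temperature`,
      `varianceLimit_iff_unit_temperature`: constants depend on `(ω₂, lam·T, β·T, γ)` only; `T → 0⁺` is the
      harmonic corner for both stubs, nothing uniform in `T` is provable.
  (6.4) RESISTANCE: `NessUnique`, `BoundaryKubo` are THEOREMS now, so `CoherentDephasing → (IncoherentChannel ↔
      FouriersLaw)` (`incoherentChannel_iff_fouriersLaw_of_coherentDephasing`) and, by the lead's
      `coherentDephasing_of_forecastLoss`, `stub_forecastLoss → (IncoherentChannel ↔ FouriersLaw ↔ stub_varianceLimit)`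
      (`…_of_forecastLoss`, `varianceLimit_iff_fouriersLaw_of_forecastLoss'`): the only line-specific disprover
      target is the engine; everything else is a disproof of the conjunct.
  (6.5) WHAT THE ENGINE MUST DELIVER ON ONE BATH MOMENTUM (no coherent echo): `a_N(t)² ≤ T·S_N(t)` for
      `a_N = ⟨p_N, K_t p_N⟩` (`endAutocorr_sq_le`), `S_N(0) = T` (`fnorm_zero`, so `T ≤ C`), hence the N-UNIFORM
      envelope `a_N² ≤ TC(1+t)^(-α)` (`endAutocorr_envelope_of_forecastEnvelope`) — at the harmonic corner the wave
      reflected by the far bath returns at `t ≈ 2N/v` with amplitude `≳ N^(-1/2)`, exactly such an echo.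
  (6.6) WHY THE ENGINE RESISTS (census of attempted kills, no theorem): (i) S-oddness — `v_t` is odd under
      `(q,p) ↦ (−q,−p)` (a symmetry in law of dynamics + Gibbs), every functional of the conserved energy field is
      even, so no LINEAR hydrodynamic (diffusive `t^(-1/2)`) tail can enter `S_N`; products odd×even decay at the
      odd factor's rate; (ii) the forecast loses skill only through the baths, but the right bath injects FRESH
      thermal phonons continuously, so a right-moving packet from depth `d` crosses `≈ d/2` of replica-decorrelated
      medium: dephased once `d ≫ ℓ(lam·T)`, horizon `τ ≈ ℓ/v` INDEPENDENT of `N` (triage MD: `τ ≈ 30` at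
      `lam·T = 1`, `≈ 105` at `0.3`; lead MD n = 64/128/256: `0.35 e^(−t/24)`, sizes coincide to 3e-4) — N-uniform
      but NOT uniform in `(ω₂, lam·T, β·T, γ)`: `τ → ∞` at weak coupling (kinetic, `ℓ ∝ (lam·T)^(-2)`), at strong
      on-site anharmonicity (anti-continuum guess — REFUTED by (6.7): τ ≈ 9 at lam·T = 10) and as `ω₂ → 0⁺`
      with `lam` small (long-wave modes: an intermediate power-law window before the exponential); the stub's
      `∃ C α` per parameter point absorbs all of this; (iii) rare cold regions of size `R` cost `e^(−cR)` and
      protect coherence for `t ≲ R/v` only ⇒ exponential, not power, tail; breathers dephase at a finite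
      phonon-scattering rate once the surrounding phonons are replica-decorrelated; (iv) kinetic theory: pinned
      dispersion has a non-trivial 2↔2 resonant manifold at every `k` (Lukkarinen2016 §2.2/§3.3), no transparent
      band; (v) the unpinned corner `ω₂ = lam = 0` WOULD break N-uniformity (centre-of-mass momentum damped only at
      the ends at rate `∼ γ/N` ⇒ `sup_N S_N(t) ≳ T/(γt)`), but it is excluded twice (`0 < ω₂`, `0 < lam`) and the
      Gibbs measure is not even normalisable there. Verdict: NO KILL; the engine is CoherentDephasing-strength
      (it implies the rank-2 crux by the lead's composition), the core is the conjunct.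
  (6.7) NUMERICS OF THIS CYCLE (kit j019194; `num/forecast_scan.py`: two noise replicas forked from M = 2048 Gibbs
      samples (all-site thermostat, then end baths only), BAOAB dt = 0.025, T = γ = 1, t ≤ 160, se 0.016T per point /
      0.0035T per 15-unit window; S averaged over both ends). S_N(t)/T window means [5,15] [15,30] [30,45] [45,60] [60,90]
      [90,120] [120,160]:  (ω₂,lam,β) = (1, 0.2, 0.2): N = 32: 0.176 0.165 0.147 0.053 0.008 0.003 −0.002 (plateau ≈ 0.16T,
      collapse at t ≈ 45 ≈ 1.5N); N = 96: 0.162 0.148 0.140 0.128 0.115 0.099 0.049 (plateau 0.16T, intrinsic decline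
      τ ≈ 190 only, cutoff ≈ 135 ≈ 1.4N): at effective coupling 0.2 the accessible chains are HARMONIC-LIKE and the forecast
      norm is N-DEPENDENT (max_t |S_32 − S_96| = 0.164 at t = 93.5, 7σ; the plateau EXTENDS with N) — the dephasing length
      exceeds 96 sites, so any envelope constant there obeys C(0.2) ≥ 0.16·(1 + 1.4·96)^α > 2.9e3·T (and ≳ 1e5·T if
      ℓ(0.2) ≈ 25·ℓ(1) ≈ 600 as (lam·T)^(-2) suggests); NOT a kill (∃ C per parameter point; the N-uniform regime N ≫ ℓ(0.2)
      is beyond N = 96), but the quantitative face of §6.3's parameter non-uniformity. (1, 10, 1) (anti-continuum guess of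
      (6.6)(ii) was WRONG — strong on-site quartic is locally chaotic): 0.049/0.044 at [5,15], then noise; τ ≈ 9, N = 32 and
      96 coincide within 2.8σ everywhere. (0.05, 0.05, 1) near-FPU: N = 32: 0.269 0.164 0.017 0.003 … (chain-limited
      collapse at t ≈ 45); N = 96: 0.265 0.194 0.132 0.096 0.051 0.001 (smooth, τ ≈ 40 on [30,80]). Control (1,1,1),
      N = 64: 0.169 0.116 0.078 0.046 0.018 −0.003 (lead: 0.35e^(−t/24), consistent scale). No coherent echo ≥ 0.05T in
      a_N(t) anywhere (noise-limited). Proposed follow-up for the lead / next cycle: coupling 0.2 at N = 192, 384, t ≤ 600 —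
      does the plateau end at an N-independent time ℓ(0.2)/v or keep tracking 1.4N?

## What could still kill it
Only physics (every statement-level and degenerate-corner attack is now closed by a theorem): (i) `CoherentDephasing` false with a NON-convergent coherent part (then `a_N` need not
converge even if Fourier's law holds) — an odd hidden conserved quantity / transparent band, cf. the
Mazur barrier; (ii) Fourier's law false for this chain (κ_N ↛ const), against all numerics; (iii) a
fixed-`N` failure of integrability of the 4-point function on `(0,∞)` for infinitely many `N` (§1) —
excluded in substance by CEHR 2018 exponential ergodicity at fixed `N`.
-/

noncomputable section

namespace Summit.AtomisticToContinuum.FouriersLaw.Cruxes.IncoherentChannel.Disproof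

open MeasureTheory Filter Topology Set
open scoped NNReal
open Literature.MathematicalPhysics.KineticTheory.HeatConduction
open Literature.Probability.Process
open Literature.Barriers.AtomisticToContinuum.HeatConduction (hamiltonian_smul partialQ_hamiltonian_scaled)
open Summit.AtomisticToContinuum.FouriersLaw.Theses.PhononMeanFreePath

/-! ## §0 Vocabulary: the two-point function `r_N`, the power covariance `C_N`, the cumulant
channel and the sequence `a_N` (definitionally the crux's integrand) -/

/-- `r_N(t) = ∫ p₀ · (K_t p_N)(z) dμ₀(z)` — the equilibrium momentum pair correlation of the two END
sites of the `(N+1)`-site chain. [folklore] -/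
def rN (ω₂ lam β γ T : ℝ) (N : ℕ) (t : ℝ) : ℝ :=
  ∫ z, z.2 0 * (∫ y, y.2 (Fin.last N)
    ∂((pinnedChain ω₂ lam β γ).transitionKernel (N + 1) T T t.toNNReal z))
    ∂((pinnedChain ω₂ lam β γ).gibbsMeasure (N + 1) T)

/-- `C_N(t) = ∫ p₀² (K_t p_N²) dμ₀ - (∫ p₀² dμ₀)(∫ K_t p_N² dμ₀)` — the power–power covariance.
[folklore] -/
def CN (ω₂ lam β γ T : ℝ) (N : ℕ) (t : ℝ) : ℝ :=
  (∫ z, (z.2 0) ^ 2 * (∫ y, (y.2 (Fin.last N)) ^ 2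
      ∂((pinnedChain ω₂ lam β γ).transitionKernel (N + 1) T T t.toNNReal z))
      ∂((pinnedChain ω₂ lam β γ).gibbsMeasure (N + 1) T)) -
    (∫ z, (z.2 0) ^ 2 ∂((pinnedChain ω₂ lam β γ).gibbsMeasure (N + 1) T)) *
      (∫ z, (∫ y, (y.2 (Fin.last N)) ^ 2
        ∂((pinnedChain ω₂ lam β γ).transitionKernel (N + 1) T T t.toNNReal z))
        ∂((pinnedChain ω₂ lam β γ).gibbsMeasure (N + 1) T))

/-- The connected four-point (cumulant) channel `C_N(t) - 2 r_N(t)²`. [folklore] -/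
def cum (ω₂ lam β γ T : ℝ) (N : ℕ) (t : ℝ) : ℝ :=
  CN ω₂ lam β γ T N t - 2 * rN ω₂ lam β γ T N t ^ 2

/-- The crux's sequence `a_N = N (γ²/T²) ∫_{t>0} [C_N - 2 r_N²]`. [folklore] -/
def seqA (ω₂ lam β γ T : ℝ) (N : ℕ) : ℝ :=
  (N : ℝ) * (γ ^ 2 / T ^ 2) * ∫ t in Ioi (0 : ℝ), cum ω₂ lam β γ T N t

/-- The crux AT ONE PARAMETER POINT: `∃ κ > 0, a_N → κ`. [folklore] -/
def At (ω₂ lam β γ T : ℝ) : Prop :=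
  ∃ κ : ℝ, 0 < κ ∧ Tendsto (seqA ω₂ lam β γ T) atTop (𝓝 κ)

/-- The crux is, definitionally, `At` at every admissible parameter point. [folklore] -/
theorem incoherentChannel_iff :
    IncoherentChannel ↔ ∀ ω₂ lam β γ : ℝ, 0 < ω₂ → 0 < lam → 0 < β → 0 < γ →
      ∀ T : ℝ, 0 < T → At ω₂ lam β γ T :=
  Iff.rfl

/-! ## §1 Structural consequences of `At` (what a proof must deliver; what a disproof may aim at) -/

/-- The limit `κ` is unique. [folklore] -/
theorem At.kappa_unique {ω₂ lam β γ T κ₁ κ₂ : ℝ}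
    (h₁ : Tendsto (seqA ω₂ lam β γ T) atTop (𝓝 κ₁)) (h₂ : Tendsto (seqA ω₂ lam β γ T) atTop (𝓝 κ₂)) :
    κ₁ = κ₂ :=
  tendsto_nhds_unique h₁ h₂

/-- `At` forces the sequence to be eventually POSITIVE. [folklore] -/
theorem At.eventually_pos {ω₂ lam β γ T : ℝ} (h : At ω₂ lam β γ T) :
    ∀ᶠ N in atTop, 0 < seqA ω₂ lam β γ T N := by
  obtain ⟨κ, hκ, hlim⟩ := h
  exact hlim.eventually (lt_mem_nhds hκ)

/-- Hence the time-integrated cumulant channel is eventually POSITIVE: a SIGN prediction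
(`∫_{t>0} cum₄(p₀,p₀,p_N(t),p_N(t)) dt > 0` for all large `N`), testable by equilibrium MD.
[folklore] -/
theorem At.eventually_integral_pos {ω₂ lam β γ T : ℝ} (h : At ω₂ lam β γ T) :
    ∀ᶠ N in atTop, 0 < ∫ t in Ioi (0 : ℝ), cum ω₂ lam β γ T N t := by
  filter_upwards [h.eventually_pos] with N hN
  by_contra hI
  have hI' : ∫ t in Ioi (0 : ℝ), cum ω₂ lam β γ T N t ≤ 0 := not_lt.1 hI
  have h0 : 0 ≤ (N : ℝ) * (γ ^ 2 / T ^ 2) := by positivity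
  exact absurd hN (not_lt.2 (mul_nonpos_of_nonneg_of_nonpos h0 hI'))

/-- HIDDEN FIXED-`N` CONTENT: `At` forces `t ↦ C_N(t) - 2 r_N(t)²` to be Lebesgue-INTEGRABLE on
`(0, ∞)` for all large `N` (a non-integrable integrand has Bochner integral `0`, which is not `> 0`).
So any proof must contain a fixed-`N` mixing statement for these unbounded observables of the
equilibrium open chain (true in substance: CEHR 2018 exponential convergence in the `e^{θH}`-weighted
norm), and the statement cannot be junk-true. [folklore] -/
theorem At.eventually_integrableOn {ω₂ lam β γ T : ℝ} (h : At ω₂ lam β γ T) :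
    ∀ᶠ N in atTop, IntegrableOn (cum ω₂ lam β γ T N) (Ioi 0) := by
  filter_upwards [h.eventually_integral_pos] with N hN
  by_contra hI
  rw [integral_undef hI] at hN
  exact lt_irrefl _ hN

/-- JUNK-ROBUSTNESS, contrapositive form: if the cumulant channel fails to be integrable on
`(0,∞)` for infinitely many `N`, the crux FAILS at that parameter point. [folklore] -/
theorem not_At_of_frequently_not_integrableOn {ω₂ lam β γ T : ℝ}
    (h : ∃ᶠ N in atTop, ¬ IntegrableOn (cum ω₂ lam β γ T N) (Ioi 0)) : ¬ At ω₂ lam β γ T := by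
  intro hAt
  obtain ⟨N, h1, h2⟩ := (h.and_eventually hAt.eventually_integrableOn).exists
  exact h1 h2

/-- If the sequence vanishes identically, `At` fails (used by every degenerate corner below).
[folklore] -/
theorem not_At_of_seqA_eq_zero {ω₂ lam β γ T : ℝ} (h : ∀ N, seqA ω₂ lam β γ T N = 0) :
    ¬ At ω₂ lam β γ T := by
  rintro ⟨κ, hκ, hlim⟩
  have hfun : seqA ω₂ lam β γ T = fun _ => 0 := funext h
  have h0 : Tendsto (seqA ω₂ lam β γ T) atTop (𝓝 0) := by
    rw [hfun]; exact tendsto_const_nhds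
  have hκ0 : κ = 0 := tendsto_nhds_unique hlim h0
  exact (lt_irrefl (0 : ℝ)) (hκ0 ▸ hκ)


/-- The support item `IncoherentBounded` (stmt-11815) is a formal COROLLARY of the crux: a convergent
real sequence is bounded. (So 11815 is staging, not extra content; conversely a disproof of 11815 —
`|a_N|` unbounded at some parameter point — kills the crux.) [folklore] -/
theorem incoherentBounded_of_incoherentChannel (h : IncoherentChannel) : IncoherentBounded := by
  intro ω₂ lam β γ hω hl hβ hγ T hT
  obtain ⟨κ, -, hlim⟩ := h ω₂ lam β γ hω hl hβ hγ T hT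
  obtain ⟨B₁, hB₁⟩ := hlim.bddAbove_range
  obtain ⟨B₂, hB₂⟩ := hlim.bddBelow_range
  refine ⟨max B₁ (-B₂), fun N => ?_⟩
  have h1 : seqA ω₂ lam β γ T N ≤ B₁ := hB₁ ⟨N, rfl⟩
  have h2 : B₂ ≤ seqA ω₂ lam β γ T N := hB₂ ⟨N, rfl⟩
  show |seqA ω₂ lam β γ T N| ≤ max B₁ (-B₂)
  rw [abs_le]
  constructor
  · have := le_max_right B₁ (-B₂); linarith
  · exact h1.trans (le_max_left _ _)

/-! ## §2 Load-bearing hypotheses: each dropped positivity makes the statement FALSE -/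

/-- The crux with the bath coupling allowed to vanish (`0 ≤ γ` instead of `0 < γ`). [folklore] -/
def CruxWithoutGammaPos : Prop :=
  ∀ ω₂ lam β γ : ℝ, 0 < ω₂ → 0 < lam → 0 < β → 0 ≤ γ → ∀ T : ℝ, 0 < T → At ω₂ lam β γ T

/-- At `γ = 0` (no baths) the prefactor `γ²/T²` kills the sequence: `a_N ≡ 0 ↛ κ > 0`.
Any proof must use `γ > 0`. [folklore] -/
theorem seqA_gamma_zero (ω₂ lam β T : ℝ) (N : ℕ) : seqA ω₂ lam β 0 T N = 0 := by
  simp [seqA]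

theorem cruxWithoutGammaPos_false : ¬ CruxWithoutGammaPos := fun h =>
  not_At_of_seqA_eq_zero (seqA_gamma_zero 1 1 1 1) (h 1 1 1 0 one_pos one_pos one_pos le_rfl 1 one_pos)

/-- The crux with the temperature allowed to vanish (`0 ≤ T`). [folklore] -/
def CruxWithoutTPos : Prop :=
  ∀ ω₂ lam β γ : ℝ, 0 < ω₂ → 0 < lam → 0 < β → 0 < γ → ∀ T : ℝ, 0 ≤ T → At ω₂ lam β γ T

/-- At `T = 0` the prefactor `γ²/T²` is the junk `γ²/0 = 0` (and `μ₀ = volume.tilted (-H/0)` is the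
ZERO measure): `a_N ≡ 0`. The typed statement genuinely needs `T > 0`. [folklore] -/
theorem seqA_T_zero (ω₂ lam β γ : ℝ) (N : ℕ) : seqA ω₂ lam β γ 0 N = 0 := by
  simp [seqA]

theorem cruxWithoutTPos_false : ¬ CruxWithoutTPos := fun h =>
  not_At_of_seqA_eq_zero (seqA_T_zero 1 1 1 1) (h 1 1 1 1 one_pos one_pos one_pos one_pos 0 le_rfl)

/-- The crux with anharmonicity allowed to vanish (`0 ≤ lam`, `0 ≤ β`): the HARMONIC corner
`lam = β = 0` is admitted. [folklore] -/
def CruxWithoutAnharmonicity : Prop :=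
  ∀ ω₂ lam β γ : ℝ, 0 < ω₂ → 0 ≤ lam → 0 ≤ β → 0 < γ → ∀ T : ℝ, 0 < T → At ω₂ lam β γ T

/-- GAUSSIAN FOUR-POINT (Wick/Isserlis) IDENTITY of the harmonic corner: for the pinned HARMONIC
chain (`lam = β = 0`) started in its Gibbs (Gaussian) state, `(p₀(0), p_N(t))` is a centred jointly
Gaussian pair, so `Cov(p₀², p_N(t)²) = 2 Cov(p₀, p_N(t))²`, i.e. `C_N ≡ 2 r_N²` — the cumulant
channel is EMPTY. TRUE in substance (Ornstein–Uhlenbeck process; Rieder–Lebowitz–Lieb 1967); in the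
tree it needs the identification of `transitionKernel` at `lam = β = 0` with the OU law (the same
missing link as support item `HarmonicCoherentPersistence`, stmt-11814) plus Isserlis' theorem —
neither is in Mathlib/Literature yet, so it is carried here as an explicit hypothesis.
[cite: RiederLebowitzLieb1967] -/
def HarmonicWick (ω₂ γ T : ℝ) : Prop :=
  ∀ (N : ℕ) (t : ℝ), 0 < t → CN ω₂ 0 0 γ T N t = 2 * rN ω₂ 0 0 γ T N t ^ 2

/-- Under the Wick identity the cumulant channel of the harmonic chain vanishes identically, so
`a_N ≡ 0` there. [folklore] -/
theorem seqA_harmonic_eq_zero {ω₂ γ T : ℝ} (hW : HarmonicWick ω₂ γ T) (N : ℕ) :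
    seqA ω₂ 0 0 γ T N = 0 := by
  have h : ∫ t in Ioi (0 : ℝ), cum ω₂ 0 0 γ T N t = ∫ t in Ioi (0 : ℝ), (0 : ℝ) := by
    refine setIntegral_congr_fun measurableSet_Ioi fun t ht => ?_
    simp only [cum, hW N t ht, sub_self]
  simp [seqA, h]

/-- **The harmonic corner refutes the crux-without-anharmonicity, modulo the Wick identity**:
`HarmonicWick ω₂ γ T → ¬ At ω₂ 0 0 γ T`. With `lam = β = 0` admitted the statement is FALSE — the
incoherent channel carries NOTHING in a Gaussian chain (all transport is coherent/ballistic,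
`HarmonicChainBallisticFlux`). So any proof of the crux must use `lam > 0 ∨ β > 0` in an essential,
non-perturbative way (and by the scaling conjugacy `(lam,β,T) ≡ (lamT,βT,1)` nothing uniform as
`T → 0` can hold). [folklore] -/
theorem not_At_harmonic_of_wick {ω₂ γ T : ℝ} (hW : HarmonicWick ω₂ γ T) : ¬ At ω₂ 0 0 γ T :=
  not_At_of_seqA_eq_zero (seqA_harmonic_eq_zero hW)

theorem cruxWithoutAnharmonicity_false_of_wick {ω₂ γ T : ℝ} (hω : 0 < ω₂) (hγ : 0 < γ) (hT : 0 < T)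
    (hW : HarmonicWick ω₂ γ T) : ¬ CruxWithoutAnharmonicity := fun h =>
  not_At_harmonic_of_wick hW (h ω₂ 0 0 γ hω le_rfl le_rfl hγ T hT)

/-! ## §3 Why it resists: given the sibling items the crux is EXACTLY Fourier's law -/

/-- **Converse of the route's deciding theorem.** Given weak-NESS uniqueness, the boundary Kubo
identity and coherent dephasing, Fourier's law (the sub-problem Statement decl) IMPLIES the crux:
`D_{N+1} = N(γ²/T²)∫C_N → κ(T)` along the canonical steady-state family, the coherent part
`2(γ²/T²)·N∫r_N² → 0`, so `a_N → κ(T) > 0`. Hence, with `closes`, under `NessUnique ∧ BoundaryKubo ∧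
CoherentDephasing` the crux is EQUIVALENT to `FouriersLaw`: a disproof of the crux with the siblings
standing is a disproof of Fourier's law for the pinned anharmonic chain, and nothing cheaper.
[cite: BonettoLebowitzReyBellet2000, §5.3 eq. (33)] -/
theorem incoherentChannel_of_fouriersLaw (hU : NessUnique) (hK : BoundaryKubo)
    (hA : CoherentDephasing) (hF : _root_.FouriersLaw) : IncoherentChannel := by
  intro ω₂ lam β γ hω hl hβ hγ T hT
  obtain ⟨-, κ, hκpos, hκ⟩ := hF ω₂ lam β γ hω hl hβ hγ
  classical
  -- the canonical steady-state family (existence is a proved Literature fact; junk `0` off the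
  -- positive quadrant of temperatures)
  let μ : (N : ℕ) → ℝ → ℝ → Measure (PhaseSpace N) := fun N T_L T_R =>
    if h : 0 < T_L ∧ 0 < T_R then
      Classical.choose (pinnedChain_exists_isSteadyState hω hl hβ hγ N h.1 h.2) else 0
  have hμ : ∀ (N : ℕ) (T_L T_R : ℝ), 0 < T_L → 0 < T_R →
      (pinnedChain ω₂ lam β γ).IsSteadyState N T_L T_R (μ N T_L T_R) := by
    intro N T_L T_R hL hR
    simp only [μ, dif_pos (And.intro hL hR)]
    exact Classical.choose_spec (pinnedChain_exists_isSteadyState hω hl hβ hγ N hL hR)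
  obtain ⟨D, hD, hDlim⟩ := hκ μ hμ T hT
  have huniq := hU ω₂ lam β γ hω hl hβ hγ
  have hKT := hK ω₂ lam β γ hω hl hβ hγ huniq μ hμ T hT
  have hAT := hA ω₂ lam β γ hω hl hβ hγ T hT
  -- identify D (N+1) with the boundary Kubo expression
  have hDK : ∀ N : ℕ, D (N + 1) = (N : ℝ) * (γ ^ 2 / T ^ 2) * ∫ t in Ioi (0 : ℝ), CN ω₂ lam β γ T N t :=
    fun N => tendsto_nhds_unique (hD (N + 1)) (hKT N).2
  have hC : Tendsto (fun N : ℕ => (N : ℝ) * (γ ^ 2 / T ^ 2) * ∫ t in Ioi (0 : ℝ), CN ω₂ lam β γ T N t)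
      atTop (𝓝 (κ T)) := by
    have h := hDlim.comp (tendsto_add_atTop_nat 1)
    refine h.congr fun N => ?_
    simp only [Function.comp_apply, hDK]
  have hr : Tendsto (fun N : ℕ => (N : ℝ) * ∫ t in Ioi (0 : ℝ), rN ω₂ lam β γ T N t ^ 2) atTop (𝓝 0) :=
    hAT.2
  refine ⟨κ T, hκpos T hT, ?_⟩
  have hsplit : ∀ N : ℕ, seqA ω₂ lam β γ T N =
      (N : ℝ) * (γ ^ 2 / T ^ 2) * (∫ t in Ioi (0 : ℝ), CN ω₂ lam β γ T N t) -
        2 * (γ ^ 2 / T ^ 2) * ((N : ℝ) * ∫ t in Ioi (0 : ℝ), rN ω₂ lam β γ T N t ^ 2) := by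
    intro N
    have hIC : IntegrableOn (CN ω₂ lam β γ T N) (Ioi 0) := (hKT N).1
    have hIr : IntegrableOn (fun t => 2 * rN ω₂ lam β γ T N t ^ 2) (Ioi 0) := (hAT.1 N).const_mul 2
    simp only [seqA, cum]
    rw [integral_sub hIC hIr, integral_const_mul]
    ring
  show Tendsto (seqA ω₂ lam β γ T) atTop (𝓝 (κ T))
  rw [show seqA ω₂ lam β γ T = fun N : ℕ => (N : ℝ) * (γ ^ 2 / T ^ 2) * (∫ t in Ioi (0 : ℝ), CN ω₂ lam β γ T N t) -
        2 * (γ ^ 2 / T ^ 2) * ((N : ℝ) * ∫ t in Ioi (0 : ℝ), rN ω₂ lam β γ T N t ^ 2) from funext hsplit]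
  simpa using hC.sub (hr.const_mul (2 * (γ ^ 2 / T ^ 2)))

/-- Under the three sibling items the crux is equivalent to the sub-problem conjunct. [folklore] -/
theorem incoherentChannel_iff_fouriersLaw (hU : NessUnique) (hK : BoundaryKubo) (hA : CoherentDephasing) :
    IncoherentChannel ↔ _root_.FouriersLaw :=
  ⟨closes hU hK hA, incoherentChannel_of_fouriersLaw hU hK hA⟩

/-! ## §4 Normal form: the amplitude-scaling conjugacy at KERNEL level and the unit-temperature slice

The tree proves the scaling conjugacy `(q,p) ↦ (sq,sp)`, `(lam,β,T) ↦ (lam s², β s², T/s²)… ` only for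
the generator / weak steady states / currents (`LowTemperatureWeakAnharmonicity`). Here it is pushed
through the CONSTRUCTED objects the crux is typed with: the pathwise flow (uniqueness of the Langevin
integral equation), the solution map, the transition kernels (push-forward), the Gibbs integrals
(tilted Lebesgue measure, Jacobian cancels) — whence `a_N(lam,β,s²T) = a_N(lam s²,β s²,T)` EXACTLY and
the crux is equivalent to its `T = 1` slice. -/

section Scaling

variable {ω₂ lam β γ : ℝ} (hω : 0 < ω₂) (hl : 0 ≤ lam) (hβ : 0 ≤ β) (hγ : 0 ≤ γ) (N : ℕ)

/-- Notation-free abbreviations would be defs; we keep everything inline. -/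
theorem drift_smul {s : ℝ} (hs : s ≠ 0) (x : PhaseSpace N) :
    (pinnedChain ω₂ lam β γ).drift N (s • x) =
      s • (pinnedChain ω₂ (lam * s ^ 2) (β * s ^ 2) γ).drift N x := by
  have hQ : ∀ i : Fin N, partialQ i ((pinnedChain ω₂ lam β γ).hamiltonian N) (s • x) =
      s * partialQ i ((pinnedChain ω₂ (lam * s ^ 2) (β * s ^ 2) γ).hamiltonian N) x := by
    intro i
    rw [partialQ_hamiltonian_scaled ω₂ lam β γ hs i x]
    field_simp
  have hγ1 : (pinnedChain ω₂ lam β γ).γ = γ := rfl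
  have hγ2 : (pinnedChain ω₂ (lam * s ^ 2) (β * s ^ 2) γ).γ = γ := rfl
  ext i
  · simp [OscillatorChain.drift]
  · simp only [OscillatorChain.drift, Prod.smul_snd, Pi.smul_apply, smul_eq_mul, hγ1, hγ2]
    rw [hQ i]
    ring

/-- The forcing path scales: `forcing (s•x) (s•η) = s • forcing x η`. [folklore] -/
theorem forcing_smul (s : ℝ) (x : PhaseSpace N) (η : ℝ → Fin N → ℝ) (r : ℝ) :
    OscillatorChain.forcing (s • x) (s • η) r = s • OscillatorChain.forcing x η r := by
  simp only [OscillatorChain.forcing, smul_add, Prod.smul_mk, smul_zero, Pi.smul_apply]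

include hω hl hβ hγ in
/-- **Flow conjugacy** (pathwise amplitude scaling): for a continuous noise path `η` and `s ≠ 0`,
`Φ^{lam,β}_t(s•x, s•η) = s • Φ^{lam s²,β s²}_t(x, η)` — the scaled flow solves the scaled integral
equation (`drift_smul`), and (IE) has a unique continuous solution. [folklore] -/
theorem chainFlow_smul {s : ℝ} (hs : s ≠ 0) (x : PhaseSpace N) {η : ℝ → Fin N → ℝ}
    (hη : Continuous η) (t : ℝ) :
    (pinnedChain ω₂ lam β γ).chainFlow N (s • x) (s • η) t =
      s • (pinnedChain ω₂ (lam * s ^ 2) (β * s ^ 2) γ).chainFlow N x η t := by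
  have hl' : 0 ≤ lam * s ^ 2 := by positivity
  have hβ' : 0 ≤ β * s ^ 2 := by positivity
  have hη' : Continuous (s • η) := hη.const_smul s
  rcases le_or_gt t 0 with ht | ht
  · rw [pinnedChain_chainFlow_of_nonpos ω₂ lam β γ N (s • x) hη' ht,
      pinnedChain_chainFlow_of_nonpos ω₂ _ _ γ N x hη ht]
    simp only [smul_add, Prod.smul_mk, smul_zero, Pi.smul_apply]
  · set z : ℝ → PhaseSpace N := fun r =>
      s • (pinnedChain ω₂ (lam * s ^ 2) (β * s ^ 2) γ).chainFlow N x η r with hz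
    have hzc : Continuous z := (pinnedChain_continuous_chainFlow hω hl' hβ' hγ N x hη).const_smul s
    have hsol : Literature.Analysis.ODE.IsIntegralSolutionOn ((pinnedChain ω₂ lam β γ).drift N)
        (OscillatorChain.forcing (s • x) (s • η)) z t := by
      intro r hr
      have h' := pinnedChain_isIntegralSolutionOn_chainFlow hω hl' hβ' hγ N x hη t r hr
      simp only [hz]
      rw [h', smul_add, forcing_smul, ← intervalIntegral.integral_smul]
      congr 1
      congr 1
      funext τ
      exact (drift_smul N hs _).symm
    exact (pinnedChain_eqOn_chainFlow hω hl hβ hγ N (s • x) hη' hsol hzc ⟨ht.le, le_rfl⟩).symm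

/-- Noise amplitudes enter `chainNoise` linearly. [folklore] -/
theorem chainNoise_smul (s c_L c_R : ℝ) (w : WienerPair) :
    chainNoise N (s * c_L) (s * c_R) w = s • chainNoise N c_L c_R w := by
  funext t i
  simp only [chainNoise, Pi.smul_apply, smul_eq_mul]
  split_ifs <;> ring

/-- `√(2γ·s²a) = s·√(2γa)` for `s ≥ 0` (both sides are the junk `0` when `γa < 0`). [folklore] -/
theorem sqrt_two_mul_mul_sq_mul (γ' : ℝ) {s : ℝ} (hs : 0 ≤ s) (a : ℝ) :
    Real.sqrt (2 * γ' * (s ^ 2 * a)) = s * Real.sqrt (2 * γ' * a) := by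
  rw [show 2 * γ' * (s ^ 2 * a) = s ^ 2 * (2 * γ' * a) by ring, Real.sqrt_mul (sq_nonneg s),
    Real.sqrt_sq hs]

include hω hl hβ hγ in
/-- **Solution-map conjugacy**: bath temperatures scale like energies (`T ↦ s²T`, amplitudes
`√(2γT) ↦ s√(2γT)`), so `Φ^{lam,β; s²T_L,s²T_R}_t(s•x, w) = s • Φ^{lam s²,β s²; T_L,T_R}_t(x, w)` for
every pair of raw driving paths `w` and `s > 0`. [folklore] -/
theorem solMap_smul {s : ℝ} (hs : 0 < s) (T_L T_R t : ℝ) (x : PhaseSpace N) (w : WienerPair) :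
    (pinnedChain ω₂ lam β γ).solMap N (s ^ 2 * T_L) (s ^ 2 * T_R) t (s • x) w =
      s • (pinnedChain ω₂ (lam * s ^ 2) (β * s ^ 2) γ).solMap N T_L T_R t x w := by
  unfold OscillatorChain.solMap
  have hγ1 : (pinnedChain ω₂ lam β γ).γ = γ := rfl
  have hγ2 : (pinnedChain ω₂ (lam * s ^ 2) (β * s ^ 2) γ).γ = γ := rfl
  rw [hγ1, hγ2, sqrt_two_mul_mul_sq_mul γ hs.le, sqrt_two_mul_mul_sq_mul γ hs.le, chainNoise_smul]
  exact chainFlow_smul hω hl hβ hγ N hs.ne' x (continuous_chainNoise _ _ w) t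

include hω hl hβ hγ in
/-- **Transition-kernel conjugacy**: `P^{lam,β; s²T_L,s²T_R}_t(s•x, ·)` is the push-forward of
`P^{lam s²,β s²; T_L,T_R}_t(x, ·)` under `y ↦ s•y` (`s > 0`). [folklore] -/
theorem transitionKernel_smul {s : ℝ} (hs : 0 < s) (T_L T_R : ℝ) (t : ℝ≥0) (x : PhaseSpace N) :
    (pinnedChain ω₂ lam β γ).transitionKernel N (s ^ 2 * T_L) (s ^ 2 * T_R) t (s • x) =
      ((pinnedChain ω₂ (lam * s ^ 2) (β * s ^ 2) γ).transitionKernel N T_L T_R t x).map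
        (fun y => s • y) := by
  have hl' : 0 ≤ lam * s ^ 2 := by positivity
  have hβ' : 0 ≤ β * s ^ 2 := by positivity
  rw [pinnedChain_transitionKernel_apply hω hl hβ hγ, pinnedChain_transitionKernel_apply hω hl' hβ' hγ,
    Measure.map_map (measurable_const_smul s)
      (pinnedChain_measurable_solMap_pairPath_right hω hl' hβ' hγ N T_L T_R t x)]
  congr 1
  funext ω
  simp only [Function.comp_apply]
  exact solMap_smul hω hl hβ hγ N hs T_L T_R t x (pairPath ω)

include hω hl hβ hγ in
/-- Integrals against the conjugated kernel (no measurability needed: `y ↦ s•y` is a measurable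
automorphism). [folklore] -/
theorem integral_transitionKernel_smul {s : ℝ} (hs : 0 < s) (T_L T_R : ℝ) (t : ℝ≥0)
    (x : PhaseSpace N) (h : PhaseSpace N → ℝ) :
    ∫ y, h y ∂((pinnedChain ω₂ lam β γ).transitionKernel N (s ^ 2 * T_L) (s ^ 2 * T_R) t (s • x)) =
      ∫ u, h (s • u) ∂((pinnedChain ω₂ (lam * s ^ 2) (β * s ^ 2) γ).transitionKernel N T_L T_R t x) := by
  rw [transitionKernel_smul hω hl hβ hγ N hs]
  exact integral_map_equiv (MeasurableEquiv.smul₀ s hs.ne') h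

/-- **Gibbs-measure conjugacy** at the level of integrals: `∫ g dμ^{lam,β}_{s²T} =
∫ g(s•x) dμ^{lam s²,β s²}_T(x)` for every `g` and `s ≠ 0` (tilted Lebesgue measure; the Jacobian
`|s|^{2N}` cancels between numerator and partition function; both sides are the junk `0` together
when `e^{-H/T}` is not integrable). [folklore] -/
theorem integral_gibbsMeasure_smul {s : ℝ} (hs : s ≠ 0) (T : ℝ) (g : PhaseSpace N → ℝ) :
    ∫ y, g y ∂((pinnedChain ω₂ lam β γ).gibbsMeasure N (s ^ 2 * T)) =
      ∫ x, g (s • x) ∂((pinnedChain ω₂ (lam * s ^ 2) (β * s ^ 2) γ).gibbsMeasure N T) := by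
  set H := (pinnedChain ω₂ lam β γ).hamiltonian N with hHdef
  set H' := (pinnedChain ω₂ (lam * s ^ 2) (β * s ^ 2) γ).hamiltonian N with hH'def
  simp only [OscillatorChain.gibbsMeasure_eq, integral_tilted]
  set c : ℝ := |(s ^ Module.finrank ℝ (PhaseSpace N))⁻¹| with hc
  have hc0 : c ≠ 0 := by
    rw [hc]
    exact abs_ne_zero.2 (inv_ne_zero (pow_ne_zero _ hs))
  haveI : (volume : Measure (PhaseSpace N)).IsAddHaarMeasure :=
    @Measure.prod.instIsAddHaarMeasure (Fin N → ℝ) _ _ _ (Fin N → ℝ) _ _ _ volume volume _ _ _ _ _ _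
  have key : ∀ G : PhaseSpace N → ℝ, ∫ y, G y = c⁻¹ * ∫ x, G (s • x) := by
    intro G
    have h1 : ∫ x, G (s • x) = c • ∫ y, G y := by
      rw [hc]
      exact Measure.integral_comp_smul volume G s
    rw [h1, smul_eq_mul, ← mul_assoc, inv_mul_cancel₀ hc0, one_mul]
  have hH : ∀ x : PhaseSpace N, -H (s • x) / (s ^ 2 * T) = -H' x / T := by
    intro x
    rw [hHdef, hH'def, hamiltonian_smul, neg_div, neg_div, mul_div_mul_left _ _ (pow_ne_zero 2 hs)]
  have hZ : (∫ y, Real.exp (-H y / (s ^ 2 * T))) = c⁻¹ * ∫ x, Real.exp (-H' x / T) := by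
    have h := key (fun y => Real.exp (-H y / (s ^ 2 * T)))
    simp only [hH] at h
    exact h
  have hmain := key (fun y => (Real.exp (-H y / (s ^ 2 * T)) / ∫ y, Real.exp (-H y / (s ^ 2 * T))) • g y)
  simp only [hH] at hmain
  rw [hmain, hZ]
  have hpt : ∀ x : PhaseSpace N,
      (Real.exp (-H' x / T) / (c⁻¹ * ∫ x, Real.exp (-H' x / T))) • g (s • x) =
        c * ((Real.exp (-H' x / T) / ∫ x, Real.exp (-H' x / T)) • g (s • x)) := by
    intro x
    simp only [smul_eq_mul]
    rw [div_mul_eq_div_div, div_inv_eq_mul]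
    ring
  simp_rw [hpt]
  rw [integral_const_mul, ← mul_assoc, inv_mul_cancel₀ hc0, one_mul]

include hω hl hβ hγ in
/-- `r_N` is an energy: `r_N(t; lam,β, s²T) = s² · r_N(t; lam s², β s², T)`. [folklore] -/
theorem rN_smul {s : ℝ} (hs : 0 < s) (T : ℝ) (n : ℕ) (t : ℝ) :
    rN ω₂ lam β γ (s ^ 2 * T) n t = s ^ 2 * rN ω₂ (lam * s ^ 2) (β * s ^ 2) γ T n t := by
  unfold rN
  rw [integral_gibbsMeasure_smul (n + 1) hs.ne' T, ← integral_const_mul]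
  refine integral_congr_ae (Eventually.of_forall fun x => ?_)
  simp only []
  rw [integral_transitionKernel_smul hω hl hβ hγ (n + 1) hs T T _ x]
  simp only [Prod.smul_snd, Pi.smul_apply, smul_eq_mul]
  rw [integral_const_mul]
  ring

include hω hl hβ hγ in
/-- `C_N` is an energy squared: `C_N(t; lam,β, s²T) = s⁴ · C_N(t; lam s², β s², T)`. [folklore] -/
theorem CN_smul {s : ℝ} (hs : 0 < s) (T : ℝ) (n : ℕ) (t : ℝ) :
    CN ω₂ lam β γ (s ^ 2 * T) n t = s ^ 4 * CN ω₂ (lam * s ^ 2) (β * s ^ 2) γ T n t := by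
  unfold CN
  rw [integral_gibbsMeasure_smul (n + 1) hs.ne' T, integral_gibbsMeasure_smul (n + 1) hs.ne' T,
    integral_gibbsMeasure_smul (n + 1) hs.ne' T]
  have h1 : ∀ x : PhaseSpace (n + 1),
      (s • x).2 0 ^ 2 * (∫ y, y.2 (Fin.last n) ^ 2
        ∂((pinnedChain ω₂ lam β γ).transitionKernel (n + 1) (s ^ 2 * T) (s ^ 2 * T) t.toNNReal (s • x))) =
      s ^ 4 * (x.2 0 ^ 2 * ∫ u, u.2 (Fin.last n) ^ 2
        ∂((pinnedChain ω₂ (lam * s ^ 2) (β * s ^ 2) γ).transitionKernel (n + 1) T T t.toNNReal x)) := by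
    intro x
    rw [integral_transitionKernel_smul hω hl hβ hγ (n + 1) hs T T _ x]
    simp only [Prod.smul_snd, Pi.smul_apply, smul_eq_mul]
    rw [show (fun u : PhaseSpace (n + 1) => (s * u.2 (Fin.last n)) ^ 2) =
        fun u => s ^ 2 * u.2 (Fin.last n) ^ 2 from funext fun u => by ring, integral_const_mul]
    ring
  have h2 : ∀ x : PhaseSpace (n + 1), (s • x).2 0 ^ 2 = s ^ 2 * x.2 0 ^ 2 := by
    intro x
    simp only [Prod.smul_snd, Pi.smul_apply, smul_eq_mul]
    ring
  have h3 : ∀ x : PhaseSpace (n + 1),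
      (∫ y, y.2 (Fin.last n) ^ 2
        ∂((pinnedChain ω₂ lam β γ).transitionKernel (n + 1) (s ^ 2 * T) (s ^ 2 * T) t.toNNReal (s • x))) =
      s ^ 2 * ∫ u, u.2 (Fin.last n) ^ 2
        ∂((pinnedChain ω₂ (lam * s ^ 2) (β * s ^ 2) γ).transitionKernel (n + 1) T T t.toNNReal x) := by
    intro x
    rw [integral_transitionKernel_smul hω hl hβ hγ (n + 1) hs T T _ x]
    simp only [Prod.smul_snd, Pi.smul_apply, smul_eq_mul]
    rw [show (fun u : PhaseSpace (n + 1) => (s * u.2 (Fin.last n)) ^ 2) =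
        fun u => s ^ 2 * u.2 (Fin.last n) ^ 2 from funext fun u => by ring, integral_const_mul]
  simp_rw [h1, h2, h3]
  rw [integral_const_mul, integral_const_mul, integral_const_mul]
  ring

include hω hl hβ hγ in
/-- The cumulant channel scales like `C_N`. [folklore] -/
theorem cum_smul {s : ℝ} (hs : 0 < s) (T : ℝ) (n : ℕ) (t : ℝ) :
    cum ω₂ lam β γ (s ^ 2 * T) n t = s ^ 4 * cum ω₂ (lam * s ^ 2) (β * s ^ 2) γ T n t := by
  unfold cum
  rw [CN_smul hω hl hβ hγ hs, rN_smul hω hl hβ hγ hs]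
  ring

include hω hl hβ hγ in
/-- **The crux sequence is scale-INVARIANT**: `a_N(lam, β, s²T) = a_N(lam s², β s², T)` — the
prefactor `γ²/T²` exactly absorbs the `s⁴` of the cumulant channel (the finite-chain, Langevin-bath
form of the Aoki–Lukkarinen–Spohn amplitude scaling). [cite: AokiLukkarinenSpohn2006, §2 eqs. (2.8)-(2.13)] -/
theorem seqA_smul {s : ℝ} (hs : 0 < s) (T : ℝ) (n : ℕ) :
    seqA ω₂ lam β γ (s ^ 2 * T) n = seqA ω₂ (lam * s ^ 2) (β * s ^ 2) γ T n := by
  unfold seqA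
  simp_rw [cum_smul hω hl hβ hγ hs T n]
  rw [integral_const_mul]
  have hs4 : s ^ 4 ≠ 0 := pow_ne_zero 4 hs.ne'
  rw [show (s ^ 2 * T) ^ 2 = s ^ 4 * T ^ 2 by ring, div_mul_eq_div_div_swap]
  rw [show (n : ℝ) * (γ ^ 2 / T ^ 2 / s ^ 4) * (s ^ 4 * ∫ t in Ioi (0 : ℝ), cum ω₂ (lam * s ^ 2) (β * s ^ 2) γ T n t) =
      (n : ℝ) * (γ ^ 2 / T ^ 2 / s ^ 4 * s ^ 4) * ∫ t in Ioi (0 : ℝ), cum ω₂ (lam * s ^ 2) (β * s ^ 2) γ T n t by ring,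
    div_mul_cancel₀ _ hs4]

include hω hl hβ hγ in
/-- Hence the crux at one parameter point is scale-invariant. [folklore] -/
theorem At_smul_iff {s : ℝ} (hs : 0 < s) (T : ℝ) :
    At ω₂ lam β γ (s ^ 2 * T) ↔ At ω₂ (lam * s ^ 2) (β * s ^ 2) γ T := by
  unfold At
  rw [show seqA ω₂ lam β γ (s ^ 2 * T) = seqA ω₂ (lam * s ^ 2) (β * s ^ 2) γ T from
    funext (seqA_smul hω hl hβ hγ hs T)]

/-- **Temperature enters only through the effective couplings `lam·T`, `β·T`**:
`At ω₂ lam β γ T ↔ At ω₂ (lam T) (β T) γ 1` for `T > 0`. [folklore] -/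
theorem At_iff_effective_couplings (hω : 0 < ω₂) (hl : 0 ≤ lam) (hβ : 0 ≤ β) (hγ : 0 ≤ γ) {T : ℝ}
    (hT : 0 < T) : At ω₂ lam β γ T ↔ At ω₂ (lam * T) (β * T) γ 1 := by
  have hs : 0 < Real.sqrt T := Real.sqrt_pos.2 hT
  have hT' : Real.sqrt T ^ 2 = T := Real.sq_sqrt hT.le
  have h := At_smul_iff (ω₂ := ω₂) (lam := lam) (β := β) (γ := γ) hω hl hβ hγ hs 1
  rwa [mul_one, hT'] at h

end Scaling

/-- **UNIT-TEMPERATURE NORMAL FORM OF THE CRUX.** `IncoherentChannel` is equivalent to its `T = 1`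
slice over all positive `(ω₂, lam, β, γ)`: the statement is a claim about a two-parameter family of
anharmonic couplings at fixed temperature (given pinning and friction), nothing can be uniform as
`T → 0` that is not uniform as `(lam, β) → 0` (harmonic corner, where the cumulant channel is EMPTY),
and a disproof may fix `T = 1`. [cite: AokiLukkarinenSpohn2006, §2 eqs. (2.8)-(2.13)] -/
theorem crux_iff_unit_temperature :
    (∀ ω₂ lam β γ : ℝ, 0 < ω₂ → 0 < lam → 0 < β → 0 < γ → ∀ T : ℝ, 0 < T → At ω₂ lam β γ T) ↔
      ∀ ω₂ lam β γ : ℝ, 0 < ω₂ → 0 < lam → 0 < β → 0 < γ → At ω₂ lam β γ 1 := by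
  constructor
  · intro h ω₂ lam β γ hω hl hβ hγ
    exact h ω₂ lam β γ hω hl hβ hγ 1 one_pos
  · intro h ω₂ lam β γ hω hl hβ hγ T hT
    rw [At_iff_effective_couplings hω hl.le hβ.le hγ.le hT]
    exact h ω₂ (lam * T) (β * T) γ hω (by positivity) (by positivity) hγ



/-! ## §5 The harmonic corner: linearity of the flow, Stein identities of the Gibbs measure, and the
Wick identity `C_N ≡ 2 r_N²` — the cumulant channel of the harmonic chain is EMPTY -/

section HarmonicFlow

variable {ω₂ γ : ℝ} (hω : 0 < ω₂) (hγ : 0 ≤ γ) (n : ℕ)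

/-- The harmonic drift is additive (linear force `Φ q`, linear friction). [folklore] -/
theorem harmonic_drift_add (a b : PhaseSpace n) :
    (pinnedChain ω₂ 0 0 γ).drift n (a + b) =
      (pinnedChain ω₂ 0 0 γ).drift n a + (pinnedChain ω₂ 0 0 γ).drift n b := by
  have hγ1 : (pinnedChain ω₂ 0 0 γ).γ = γ := rfl
  ext i
  · simp [OscillatorChain.drift]
  · simp only [OscillatorChain.drift, Prod.snd_add, Prod.fst_add, Pi.add_apply, hγ1,
      pinnedChain_harmonic_partialQ_hamiltonian, Matrix.mulVec_add]
    ring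

/-- The harmonic drift is homogeneous (every scalar). [folklore] -/
theorem harmonic_drift_smul (s : ℝ) (a : PhaseSpace n) :
    (pinnedChain ω₂ 0 0 γ).drift n (s • a) = s • (pinnedChain ω₂ 0 0 γ).drift n a := by
  have hγ1 : (pinnedChain ω₂ 0 0 γ).γ = γ := rfl
  ext i
  · simp [OscillatorChain.drift]
  · simp only [OscillatorChain.drift, Prod.smul_snd, Prod.smul_fst, Pi.smul_apply, smul_eq_mul, hγ1,
      pinnedChain_harmonic_partialQ_hamiltonian, Matrix.mulVec_smul]
    ring

/-- Forcings scale (harmonic file copy of `forcing_smul`). [folklore] -/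
theorem harmonic_forcing_smul (s : ℝ) (x : PhaseSpace n) (η : ℝ → Fin n → ℝ) (r : ℝ) :
    OscillatorChain.forcing (s • x) (s • η) r = s • OscillatorChain.forcing x η r := by
  simp only [OscillatorChain.forcing, smul_add, Prod.smul_mk, smul_zero, Pi.smul_apply]

/-- Forcings add. [folklore] -/
theorem forcing_add (x₁ x₂ : PhaseSpace n) (η₁ η₂ : ℝ → Fin n → ℝ) (r : ℝ) :
    OscillatorChain.forcing (x₁ + x₂) (η₁ + η₂) r =
      OscillatorChain.forcing x₁ η₁ r + OscillatorChain.forcing x₂ η₂ r := by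
  ext i
  · simp [OscillatorChain.forcing]
  · simp [OscillatorChain.forcing]; ring

include hω hγ in
/-- **Superposition for the harmonic flow**: `Φ_t(x₁+x₂, η₁+η₂) = Φ_t(x₁,η₁) + Φ_t(x₂,η₂)` for
continuous noise paths (uniqueness of the Langevin integral equation with LINEAR drift). [folklore] -/
theorem harmonic_chainFlow_add (x₁ x₂ : PhaseSpace n) {η₁ η₂ : ℝ → Fin n → ℝ}
    (h₁ : Continuous η₁) (h₂ : Continuous η₂) (t : ℝ) :
    (pinnedChain ω₂ 0 0 γ).chainFlow n (x₁ + x₂) (η₁ + η₂) t =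
      (pinnedChain ω₂ 0 0 γ).chainFlow n x₁ η₁ t + (pinnedChain ω₂ 0 0 γ).chainFlow n x₂ η₂ t := by
  have h12 : Continuous (η₁ + η₂) := h₁.add h₂
  rcases le_or_gt t 0 with ht | ht
  · rw [pinnedChain_chainFlow_of_nonpos ω₂ 0 0 γ n (x₁ + x₂) h12 ht,
      pinnedChain_chainFlow_of_nonpos ω₂ 0 0 γ n x₁ h₁ ht, pinnedChain_chainFlow_of_nonpos ω₂ 0 0 γ n x₂ h₂ ht]
    ext i
    · simp
    · simp; ring
  · set z : ℝ → PhaseSpace n := fun r =>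
      (pinnedChain ω₂ 0 0 γ).chainFlow n x₁ η₁ r + (pinnedChain ω₂ 0 0 γ).chainFlow n x₂ η₂ r with hz
    have hc₁ := pinnedChain_continuous_chainFlow hω le_rfl le_rfl hγ n x₁ h₁
    have hc₂ := pinnedChain_continuous_chainFlow hω le_rfl le_rfl hγ n x₂ h₂
    have hzc : Continuous z := hc₁.add hc₂
    have hDc : Continuous ((pinnedChain ω₂ 0 0 γ).drift n) :=
      (pinnedChain_contDiff_drift ω₂ 0 0 γ n (n := 0)).continuous
    have hsol : Literature.Analysis.ODE.IsIntegralSolutionOn ((pinnedChain ω₂ 0 0 γ).drift n)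
        (OscillatorChain.forcing (x₁ + x₂) (η₁ + η₂)) z t := by
      intro r hr
      have e₁ := pinnedChain_isIntegralSolutionOn_chainFlow hω le_rfl le_rfl hγ n x₁ h₁ t r hr
      have e₂ := pinnedChain_isIntegralSolutionOn_chainFlow hω le_rfl le_rfl hγ n x₂ h₂ t r hr
      have hI₁ : IntervalIntegrable (fun τ => (pinnedChain ω₂ 0 0 γ).drift n
          ((pinnedChain ω₂ 0 0 γ).chainFlow n x₁ η₁ τ)) volume 0 r :=
        (hDc.comp hc₁).intervalIntegrable _ _
      have hI₂ : IntervalIntegrable (fun τ => (pinnedChain ω₂ 0 0 γ).drift n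
          ((pinnedChain ω₂ 0 0 γ).chainFlow n x₂ η₂ τ)) volume 0 r :=
        (hDc.comp hc₂).intervalIntegrable _ _
      simp only [hz]
      rw [e₁, e₂, forcing_add]
      simp_rw [harmonic_drift_add]
      rw [intervalIntegral.integral_add hI₁ hI₂]
      abel
    exact (pinnedChain_eqOn_chainFlow hω le_rfl le_rfl hγ n (x₁ + x₂) h12 hsol hzc ⟨ht.le, le_rfl⟩).symm

include hω hγ in
/-- Homogeneity of the harmonic flow for EVERY scalar (the case `s ≠ 0` is `chainFlow_smul` at
`lam = β = 0`; `s = 0` follows from superposition). [folklore] -/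
theorem harmonic_chainFlow_smul (s : ℝ) (x : PhaseSpace n) {η : ℝ → Fin n → ℝ} (hη : Continuous η)
    (t : ℝ) :
    (pinnedChain ω₂ 0 0 γ).chainFlow n (s • x) (s • η) t = s • (pinnedChain ω₂ 0 0 γ).chainFlow n x η t := by
  have hη' : Continuous (s • η) := hη.const_smul s
  rcases le_or_gt t 0 with ht | ht
  · rw [pinnedChain_chainFlow_of_nonpos ω₂ 0 0 γ n (s • x) hη' ht,
      pinnedChain_chainFlow_of_nonpos ω₂ 0 0 γ n x hη ht]
    simp only [smul_add, Prod.smul_mk, smul_zero, Pi.smul_apply]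
  · set z : ℝ → PhaseSpace n := fun r => s • (pinnedChain ω₂ 0 0 γ).chainFlow n x η r with hz
    have hzc : Continuous z := (pinnedChain_continuous_chainFlow hω le_rfl le_rfl hγ n x hη).const_smul s
    have hsol : Literature.Analysis.ODE.IsIntegralSolutionOn ((pinnedChain ω₂ 0 0 γ).drift n)
        (OscillatorChain.forcing (s • x) (s • η)) z t := by
      intro r hr
      have h' := pinnedChain_isIntegralSolutionOn_chainFlow hω le_rfl le_rfl hγ n x hη t r hr
      simp only [hz]
      rw [h', smul_add, harmonic_forcing_smul, ← intervalIntegral.integral_smul]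
      congr 1
      congr 1
      funext τ
      exact (harmonic_drift_smul n s _).symm
    exact (pinnedChain_eqOn_chainFlow hω le_rfl le_rfl hγ n (s • x) hη' hsol hzc ⟨ht.le, le_rfl⟩).symm

include hω hγ in
/-- **The deterministic harmonic flow is a linear map** `M_t : x ↦ Φ_t(x, 0)`. [folklore] -/
theorem harmonic_chainFlow_zero_noise_linear (t : ℝ) :
    ∃ M : PhaseSpace n →ₗ[ℝ] PhaseSpace n, ∀ x, (pinnedChain ω₂ 0 0 γ).chainFlow n x 0 t = M x := by
  refine ⟨{ toFun := fun x => (pinnedChain ω₂ 0 0 γ).chainFlow n x 0 t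
            map_add' := fun x y => ?_
            map_smul' := fun s x => ?_ }, fun x => rfl⟩
  · have h := harmonic_chainFlow_add hω hγ n x y (η₁ := 0) (η₂ := 0) continuous_const continuous_const t
    simpa using h
  · have h := harmonic_chainFlow_smul hω hγ n s x (η := 0) continuous_const t
    simp only [smul_zero] at h
    simpa using h

include hω hγ in
/-- Decomposition of the solution map: `Φ_t(x, w) = M_t x + Φ_t(0, w)` (deterministic linear response
plus the noise-driven part started at rest). [folklore] -/
theorem harmonic_solMap_eq_add (T_L T_R t : ℝ) (x : PhaseSpace n) (w : WienerPair) :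
    (pinnedChain ω₂ 0 0 γ).solMap n T_L T_R t x w =
      (pinnedChain ω₂ 0 0 γ).chainFlow n x 0 t + (pinnedChain ω₂ 0 0 γ).solMap n T_L T_R t 0 w := by
  unfold OscillatorChain.solMap
  have h := harmonic_chainFlow_add hω hγ n x 0 (η₁ := 0)
    (η₂ := chainNoise n (Real.sqrt (2 * (pinnedChain ω₂ 0 0 γ).γ * T_L))
      (Real.sqrt (2 * (pinnedChain ω₂ 0 0 γ).γ * T_R)) w) continuous_const (continuous_chainNoise _ _ w) t
  simpa using h

include hω hγ in
/-- **Kernel shift**: the harmonic transition kernel from `x` is the kernel from `0` translated by the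
deterministic flow, `P_t(x, ·) = P_t(0, ·) ∘ (y ↦ M_t x + y)⁻¹`. [folklore] -/
theorem harmonic_transitionKernel_eq_map (T_L T_R : ℝ) (t : ℝ≥0) (x : PhaseSpace n) :
    (pinnedChain ω₂ 0 0 γ).transitionKernel n T_L T_R t x =
      ((pinnedChain ω₂ 0 0 γ).transitionKernel n T_L T_R t 0).map
        (fun y => (pinnedChain ω₂ 0 0 γ).chainFlow n x 0 t + y) := by
  rw [pinnedChain_transitionKernel_apply hω le_rfl le_rfl hγ, pinnedChain_transitionKernel_apply hω le_rfl le_rfl hγ,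
    Measure.map_map (measurable_const_add _)
      (pinnedChain_measurable_solMap_pairPath_right hω le_rfl le_rfl hγ n T_L T_R t 0)]
  congr 1
  funext ω
  simp only [Function.comp_apply]
  exact harmonic_solMap_eq_add hω hγ n T_L T_R t x (pairPath ω)

include hω hγ in
/-- Integrals against the shifted kernel. [folklore] -/
theorem harmonic_integral_transitionKernel (T_L T_R : ℝ) (t : ℝ≥0) (x : PhaseSpace n)
    (f : PhaseSpace n → ℝ) :
    ∫ y, f y ∂((pinnedChain ω₂ 0 0 γ).transitionKernel n T_L T_R t x) =
      ∫ y, f ((pinnedChain ω₂ 0 0 γ).chainFlow n x 0 t + y)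
        ∂((pinnedChain ω₂ 0 0 γ).transitionKernel n T_L T_R t 0) := by
  rw [harmonic_transitionKernel_eq_map hω hγ n]
  exact integral_map_equiv (MeasurableEquiv.addLeft ((pinnedChain ω₂ 0 0 γ).chainFlow n x 0 t)) f

end HarmonicFlow

section Reflection

variable {ω₂ lam β γ : ℝ} (n : ℕ)

/-- **Reflection symmetry of every Gibbs measure of the family**: `∫ g dμ_T = ∫ g(-x) dμ_T(x)`
(the amplitude scaling with `s = -1`). [folklore] -/
theorem integral_gibbsMeasure_comp_neg (T : ℝ) (g : PhaseSpace n → ℝ) :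
    ∫ y, g y ∂((pinnedChain ω₂ lam β γ).gibbsMeasure n T) =
      ∫ x, g (-x) ∂((pinnedChain ω₂ lam β γ).gibbsMeasure n T) := by
  set H := (pinnedChain ω₂ lam β γ).hamiltonian n with hHdef
  haveI : (volume : Measure (PhaseSpace n)).IsAddHaarMeasure :=
    @Measure.prod.instIsAddHaarMeasure (Fin n → ℝ) _ _ _ (Fin n → ℝ) _ _ _ volume volume _ _ _ _ _ _
  have key : ∀ G : PhaseSpace n → ℝ, ∫ x, G ((-1 : ℝ) • x) = ∫ x, G x := by
    intro G
    rw [Measure.integral_comp_smul volume G (-1)]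
    simp
  have hH : ∀ x : PhaseSpace n, -H ((-1 : ℝ) • x) / T = -H x / T := by
    intro x
    rw [hHdef, hamiltonian_smul]
    simp
  have hH' : ∀ x : PhaseSpace n, -H (-x) / T = -H x / T := fun x => by simpa using hH x
  simp only [OscillatorChain.gibbsMeasure_eq, integral_tilted]
  rw [← hHdef, ← key (fun y => (Real.exp (-H y / T) / ∫ y, Real.exp (-H y / T)) • g y)]
  simp only [neg_one_smul, hH']

/-- Odd observables have vanishing Gibbs mean (no integrability needed). [folklore] -/
theorem integral_gibbsMeasure_eq_zero_of_odd (T : ℝ) {g : PhaseSpace n → ℝ} (hg : ∀ x, g (-x) = -g x) :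
    ∫ y, g y ∂((pinnedChain ω₂ lam β γ).gibbsMeasure n T) = 0 := by
  have h := integral_gibbsMeasure_comp_neg (ω₂ := ω₂) (lam := lam) (β := β) (γ := γ) n T g
  simp_rw [hg, integral_neg] at h
  linarith

end Reflection


section KernelMoments

variable {ω₂ lam β γ : ℝ} (hω : 0 < ω₂) (hl : 0 ≤ lam) (hβ : 0 ≤ β) (hγ : 0 ≤ γ) {n : ℕ} (hn : 0 < n)
  {T : ℝ} (hT : 0 < T)

/-- `p_i²/2 ≤ H` for the pinned chain (`ω₂ > 0`, `lam, β ≥ 0`). [folklore] -/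
theorem sq_momentum_le_two_mul_hamiltonian (hω : 0 < ω₂) (hl : 0 ≤ lam) (hβ : 0 ≤ β) (γ : ℝ)
    (x : PhaseSpace n) (i : Fin n) :
    x.2 i ^ 2 ≤ 2 * (pinnedChain ω₂ lam β γ).hamiltonian n x := by
  have h := pinnedChain_harmonic_le_hamiltonian (ω₂ := ω₂) hl hβ γ n x
  have h1 : x.2 i ^ 2 / 2 ≤ ∑ j, x.2 j ^ 2 / 2 :=
    Finset.single_le_sum (f := fun j => x.2 j ^ 2 / 2) (fun j _ => by positivity) (Finset.mem_univ i)
  have h2 : 0 ≤ ∑ j, ω₂ * x.1 j ^ 2 / 2 := Finset.sum_nonneg fun j _ => by positivity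
  linarith

/-- `ω₂ q_i²/2 ≤ H`. [folklore] -/
theorem sq_position_le_hamiltonian (hω : 0 < ω₂) (hl : 0 ≤ lam) (hβ : 0 ≤ β) (γ : ℝ)
    (x : PhaseSpace n) (i : Fin n) :
    ω₂ * x.1 i ^ 2 ≤ 2 * (pinnedChain ω₂ lam β γ).hamiltonian n x := by
  have h := pinnedChain_harmonic_le_hamiltonian (ω₂ := ω₂) hl hβ γ n x
  have h1 : ω₂ * x.1 i ^ 2 / 2 ≤ ∑ j, ω₂ * x.1 j ^ 2 / 2 :=
    Finset.single_le_sum (f := fun j => ω₂ * x.1 j ^ 2 / 2) (fun j _ => by positivity) (Finset.mem_univ i)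
  have h2 : 0 ≤ ∑ j, x.2 j ^ 2 / 2 := Finset.sum_nonneg fun j _ => by positivity
  linarith

/-- **Coercivity in the sup norm**: `‖x‖² ≤ 2 max(ω₂⁻¹, 1) · H(x)`. [folklore] -/
theorem norm_sq_le_mul_hamiltonian (hω : 0 < ω₂) (hl : 0 ≤ lam) (hβ : 0 ≤ β) (γ : ℝ) (x : PhaseSpace n) :
    ‖x‖ ^ 2 ≤ 2 * max ω₂⁻¹ 1 * (pinnedChain ω₂ lam β γ).hamiltonian n x := by
  set H := (pinnedChain ω₂ lam β γ).hamiltonian n x with hH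
  have hH0 : 0 ≤ H := pinnedChain_hamiltonian_nonneg hω.le hl hβ γ n x
  set c : ℝ := 2 * max ω₂⁻¹ 1 with hc
  have hc0 : 0 ≤ c := by positivity
  have hcoord : ∀ u : ℝ, u ^ 2 ≤ c * H → |u| ≤ Real.sqrt (c * H) := fun u hu => Real.abs_le_sqrt hu
  have hq : ∀ i, |x.1 i| ≤ Real.sqrt (c * H) := by
    intro i
    apply hcoord
    have h := sq_position_le_hamiltonian hω hl hβ γ x i
    have hω' : x.1 i ^ 2 = ω₂⁻¹ * (ω₂ * x.1 i ^ 2) := by field_simp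
    rw [hω']
    calc ω₂⁻¹ * (ω₂ * x.1 i ^ 2) ≤ ω₂⁻¹ * (2 * H) := by
          exact mul_le_mul_of_nonneg_left h (inv_nonneg.2 hω.le)
      _ ≤ c * H := by
          rw [hc]
          have : ω₂⁻¹ ≤ max ω₂⁻¹ 1 := le_max_left _ _
          nlinarith
  have hp : ∀ i, |x.2 i| ≤ Real.sqrt (c * H) := by
    intro i
    apply hcoord
    have h := sq_momentum_le_two_mul_hamiltonian hω hl hβ γ x i
    calc x.2 i ^ 2 ≤ 2 * H := h
      _ ≤ c * H := by
          rw [hc]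
          have : (1 : ℝ) ≤ max ω₂⁻¹ 1 := le_max_right _ _
          nlinarith
  have hnorm : ‖x‖ ≤ Real.sqrt (c * H) := by
    rw [Prod.norm_def]
    refine max_le ?_ ?_
    · exact (pi_norm_le_iff_of_nonneg (Real.sqrt_nonneg _)).2 fun i => by
        rw [Real.norm_eq_abs]; exact hq i
    · exact (pi_norm_le_iff_of_nonneg (Real.sqrt_nonneg _)).2 fun i => by
        rw [Real.norm_eq_abs]; exact hp i
  calc ‖x‖ ^ 2 ≤ Real.sqrt (c * H) ^ 2 := pow_le_pow_left₀ (norm_nonneg _) hnorm 2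
    _ = c * H := Real.sq_sqrt (by positivity)

include hω hl hβ hγ hn hT in
/-- `e^{H/(2T)}` is integrable for every equal-temperature transition kernel (CEHR (3.4) for the
constructed semigroup, `θ = 1/(2T)`). [cite: CuneoEckmannHairerReyBellet2018, §3 eq. (3.4)] -/
theorem integrable_exp_hamiltonian_transitionKernel (t : ℝ≥0) (z : PhaseSpace n) :
    Integrable (fun y => Real.exp (1 / (2 * T) * (pinnedChain ω₂ lam β γ).hamiltonian n y))
      ((pinnedChain ω₂ lam β γ).transitionKernel n T T t z) := by
  have hθ : 0 < 1 / (2 * T) := by positivity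
  have hθ' : 1 / (2 * T) < 1 / max T T := by
    rw [max_self]
    exact one_div_lt_one_div_of_lt hT (by linarith)
  have hbound := lintegral_exp_mul_hamiltonian_pinnedChainSemigroup_le hω hl hβ hγ hn hT.le hT.le hT hT
    hθ hθ' t z
  have hHc : Continuous ((pinnedChain ω₂ lam β γ).hamiltonian n) :=
    (pinnedChain_contDiff_hamiltonian ω₂ lam β γ n (n := 0)).continuous
  refine ⟨(Real.continuous_exp.comp (continuous_const.mul hHc)).aestronglyMeasurable, ?_⟩
  unfold HasFiniteIntegral
  have h : ∫⁻ y, ‖Real.exp (1 / (2 * T) * (pinnedChain ω₂ lam β γ).hamiltonian n y)‖ₑ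
        ∂((pinnedChain ω₂ lam β γ).transitionKernel n T T t z) =
      ∫⁻ y, ENNReal.ofReal (Real.exp (1 / (2 * T) * (pinnedChain ω₂ lam β γ).hamiltonian n y))
        ∂((pinnedChain ω₂ lam β γ).transitionKernel n T T t z) := by
    refine lintegral_congr fun y => ?_
    rw [Real.enorm_eq_ofReal_abs, abs_of_pos (Real.exp_pos _)]
  rw [h]
  exact lt_of_le_of_lt hbound ENNReal.ofReal_lt_top

include hω hl hβ hγ hn hT in
/-- `p_i²` is integrable for the equal-temperature kernels. [folklore] -/
theorem integrable_sq_momentum_transitionKernel (t : ℝ≥0) (z : PhaseSpace n) (i : Fin n) :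
    Integrable (fun y : PhaseSpace n => y.2 i ^ 2) ((pinnedChain ω₂ lam β γ).transitionKernel n T T t z) := by
  have hE := (integrable_exp_hamiltonian_transitionKernel hω hl hβ hγ hn hT t z).const_mul (2 * (2 * T))
  refine hE.mono' (by fun_prop : Continuous fun y : PhaseSpace n => y.2 i ^ 2).aestronglyMeasurable
    (Eventually.of_forall fun y => ?_)
  rw [Real.norm_eq_abs, abs_of_nonneg (sq_nonneg _)]
  have h1 := sq_momentum_le_two_mul_hamiltonian hω hl hβ γ y i
  have h2 : 1 / (2 * T) * (pinnedChain ω₂ lam β γ).hamiltonian n y ≤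
      Real.exp (1 / (2 * T) * (pinnedChain ω₂ lam β γ).hamiltonian n y) := by
    have := Real.add_one_le_exp (1 / (2 * T) * (pinnedChain ω₂ lam β γ).hamiltonian n y)
    linarith
  have hT0 : T ≠ 0 := hT.ne'
  calc y.2 i ^ 2 ≤ 2 * (pinnedChain ω₂ lam β γ).hamiltonian n y := h1
    _ = 2 * (2 * T) * (1 / (2 * T) * (pinnedChain ω₂ lam β γ).hamiltonian n y) := by field_simp
    _ ≤ 2 * (2 * T) * Real.exp (1 / (2 * T) * (pinnedChain ω₂ lam β γ).hamiltonian n y) :=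
        mul_le_mul_of_nonneg_left h2 (by positivity)

include hω hl hβ hγ hn hT in
/-- `p_i` is integrable for the equal-temperature kernels. [folklore] -/
theorem integrable_momentum_transitionKernel (t : ℝ≥0) (z : PhaseSpace n) (i : Fin n) :
    Integrable (fun y : PhaseSpace n => y.2 i) ((pinnedChain ω₂ lam β γ).transitionKernel n T T t z) := by
  haveI := pinnedChain_isMarkovKernel_transitionKernel hω hl hβ hγ n T T t
  have h1 := integrable_sq_momentum_transitionKernel hω hl hβ hγ hn hT t z i
  have h2 : Integrable (fun _ : PhaseSpace n => (1 : ℝ)) ((pinnedChain ω₂ lam β γ).transitionKernel n T T t z) :=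
    integrable_const 1
  refine (h2.add h1).mono' (by fun_prop : Continuous fun y : PhaseSpace n => y.2 i).aestronglyMeasurable
    (Eventually.of_forall fun y => ?_)
  rw [Real.norm_eq_abs]
  simp only [Pi.add_apply]
  nlinarith [sq_nonneg (|y.2 i| - 1), sq_abs (y.2 i), abs_nonneg (y.2 i)]

end KernelMoments

section HarmonicKernel

variable {ω₂ γ : ℝ} (hω : 0 < ω₂) (hγ : 0 ≤ γ) {n : ℕ} (hn : 0 < n) {T : ℝ} (hT : 0 < T)
include hω hγ hn hT

/-- **`P_t p_i(x) = (M_t x)_{p_i} + P_t p_i(0)`** for the harmonic kernel. [folklore] -/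
theorem harmonic_kernel_momentum (t : ℝ≥0) (x : PhaseSpace n) (i : Fin n) :
    ∫ y, y.2 i ∂((pinnedChain ω₂ 0 0 γ).transitionKernel n T T t x) =
      ((pinnedChain ω₂ 0 0 γ).chainFlow n x 0 t).2 i +
        ∫ y, y.2 i ∂((pinnedChain ω₂ 0 0 γ).transitionKernel n T T t 0) := by
  haveI := pinnedChain_isMarkovKernel_transitionKernel hω le_rfl le_rfl hγ n T T t
  rw [harmonic_integral_transitionKernel hω hγ n T T t x (fun y => y.2 i)]
  simp only [Prod.snd_add, Pi.add_apply]
  rw [integral_add (integrable_const _) (integrable_momentum_transitionKernel hω le_rfl le_rfl hγ hn hT t 0 i),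
    integral_const, probReal_univ, one_smul]

/-- **`P_t p_i²(x) = (M_t x)_{p_i}² + 2 (M_t x)_{p_i} P_t p_i(0) + P_t p_i²(0)`**. [folklore] -/
theorem harmonic_kernel_momentum_sq (t : ℝ≥0) (x : PhaseSpace n) (i : Fin n) :
    ∫ y, y.2 i ^ 2 ∂((pinnedChain ω₂ 0 0 γ).transitionKernel n T T t x) =
      ((pinnedChain ω₂ 0 0 γ).chainFlow n x 0 t).2 i ^ 2 +
        2 * ((pinnedChain ω₂ 0 0 γ).chainFlow n x 0 t).2 i *
          (∫ y, y.2 i ∂((pinnedChain ω₂ 0 0 γ).transitionKernel n T T t 0)) +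
        ∫ y, y.2 i ^ 2 ∂((pinnedChain ω₂ 0 0 γ).transitionKernel n T T t 0) := by
  haveI := pinnedChain_isMarkovKernel_transitionKernel hω le_rfl le_rfl hγ n T T t
  set a := ((pinnedChain ω₂ 0 0 γ).chainFlow n x 0 t).2 i with ha
  rw [harmonic_integral_transitionKernel hω hγ n T T t x (fun y => y.2 i ^ 2)]
  simp only [Prod.snd_add, Pi.add_apply]
  have hI1 := integrable_momentum_transitionKernel hω le_rfl le_rfl hγ hn hT t (0 : PhaseSpace n) i
  have hI2 := integrable_sq_momentum_transitionKernel hω le_rfl le_rfl hγ hn hT t (0 : PhaseSpace n) i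
  have hsplit : (fun y : PhaseSpace n => (a + y.2 i) ^ 2) =
      fun y => (a ^ 2 + 2 * a * y.2 i) + y.2 i ^ 2 := by
    funext y; ring
  have hI3 : Integrable (fun y : PhaseSpace n => a ^ 2 + 2 * a * y.2 i)
      ((pinnedChain ω₂ 0 0 γ).transitionKernel n T T t 0) := (integrable_const _).add (hI1.const_mul _)
  have hI4 : Integrable (fun y : PhaseSpace n => 2 * a * y.2 i)
      ((pinnedChain ω₂ 0 0 γ).transitionKernel n T T t 0) := hI1.const_mul _
  rw [← ha, hsplit, integral_add hI3 hI2, integral_add (integrable_const _) hI4, integral_const_mul,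
    integral_const, probReal_univ, one_smul]

end HarmonicKernel


section GibbsMoments

variable {ω₂ lam β γ : ℝ} (hω : 0 < ω₂) (hl : 0 ≤ lam) (hβ : 0 ≤ β) {n : ℕ} {T : ℝ} (hT : 0 < T)
include hω hl hβ hT

/-- **Polynomially growing observables are Gibbs-integrable**: a continuous `F` with
`|F| ≤ A (1 + ‖x‖²)²` is integrable against `e^{-H/T}` (`T > 0`; coercivity `‖x‖² ≤ cH` and
`(1+H)² e^{-H/T} ≤ K e^{-H/(2T)}`). [folklore] -/
theorem integrable_mul_gibbsDensity_of_growth {F : PhaseSpace n → ℝ} (hF : Continuous F) {A : ℝ}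
    (hA : ∀ x, |F x| ≤ A * (1 + ‖x‖ ^ 2) ^ 2) :
    Integrable fun x => F x * (pinnedChain ω₂ lam β γ).gibbsDensity n T x := by
  set c : ℝ := 2 * max ω₂⁻¹ 1 with hc
  have hc1 : 1 ≤ c := by
    rw [hc]; have := le_max_right ω₂⁻¹ 1; linarith
  have hs : 0 < T⁻¹ / 2 := by positivity
  have hA0 : 0 ≤ A := by
    have h := hA 0
    have h1 : (0 : ℝ) ≤ |F 0| := abs_nonneg _
    have h2 : (1 + ‖(0 : PhaseSpace n)‖ ^ 2) ^ 2 = 1 := by simp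
    rw [h2, mul_one] at h
    linarith
  -- the majorant `A c² (2e^s/s²) e^{sH} e^{-H/T}`, integrable since `s = 1/(2T) < 1/T`
  have hmaj := (pinnedChain_integrable_exp_mul_gibbsDensity hω hl hβ γ n hT
    (show T⁻¹ / 2 < 1 / T by rw [one_div]; linarith [inv_pos.2 hT])).const_mul
    (A * c ^ 2 * (2 * Real.exp (T⁻¹ / 2) / (T⁻¹ / 2) ^ 2))
  refine hmaj.mono' ((hF.mul (pinnedChain_continuous_gibbsDensity ω₂ lam β γ n T)).aestronglyMeasurable)
    (Eventually.of_forall fun x => ?_)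
  have hH0 := pinnedChain_hamiltonian_nonneg hω.le hl hβ γ n x
  set H := (pinnedChain ω₂ lam β γ).hamiltonian n x with hH
  have hρ : 0 < (pinnedChain ω₂ lam β γ).gibbsDensity n T x := (pinnedChain ω₂ lam β γ).gibbsDensity_pos n T x
  rw [Real.norm_eq_abs, abs_mul, abs_of_pos hρ]
  have hx : ‖x‖ ^ 2 ≤ c * H := norm_sq_le_mul_hamiltonian hω hl hβ γ x
  have h1 : (1 + ‖x‖ ^ 2) ^ 2 ≤ c ^ 2 * (1 + H) ^ 2 := by
    have : 1 + ‖x‖ ^ 2 ≤ c * (1 + H) := by nlinarith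
    have h0 : 0 ≤ 1 + ‖x‖ ^ 2 := by positivity
    calc (1 + ‖x‖ ^ 2) ^ 2 ≤ (c * (1 + H)) ^ 2 := pow_le_pow_left₀ h0 this 2
      _ = c ^ 2 * (1 + H) ^ 2 := by ring
  have h2 := one_add_sq_le_exp hH0 hs
  calc |F x| * (pinnedChain ω₂ lam β γ).gibbsDensity n T x
      ≤ A * (1 + ‖x‖ ^ 2) ^ 2 * (pinnedChain ω₂ lam β γ).gibbsDensity n T x :=
        mul_le_mul_of_nonneg_right (hA x) hρ.le
    _ ≤ A * (c ^ 2 * (1 + H) ^ 2) * (pinnedChain ω₂ lam β γ).gibbsDensity n T x := by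
        gcongr
    _ ≤ A * (c ^ 2 * (2 * Real.exp (T⁻¹ / 2) / (T⁻¹ / 2) ^ 2 * Real.exp (T⁻¹ / 2 * H))) *
          (pinnedChain ω₂ lam β γ).gibbsDensity n T x := by
        gcongr
    _ = A * c ^ 2 * (2 * Real.exp (T⁻¹ / 2) / (T⁻¹ / 2) ^ 2) *
          (Real.exp (T⁻¹ / 2 * H) * (pinnedChain ω₂ lam β γ).gibbsDensity n T x) := by ring

/-- Hence such observables are integrable for the Gibbs MEASURE. [folklore] -/
theorem integrable_gibbsMeasure_of_growth {F : PhaseSpace n → ℝ} (hF : Continuous F) {A : ℝ}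
    (hA : ∀ x, |F x| ≤ A * (1 + ‖x‖ ^ 2) ^ 2) :
    Integrable F ((pinnedChain ω₂ lam β γ).gibbsMeasure n T) :=
  (pinnedChain ω₂ lam β γ).integrable_gibbsMeasure (integrable_mul_gibbsDensity_of_growth hω hl hβ hT hF hA)

/-- **Stein's identity in a momentum direction (the Gibbs measure is Gaussian in every `p_i`)**:
for `F` differentiable along `e_{p_i}` with derivative `F'`, and `F, F', p_iF` of polynomial growth,
`∫ p_i F dμ_T = T ∫ F' dμ_T` — for EVERY chain of the family (anharmonic included).
[folklore] -/
theorem stein_momentum (i : Fin n) {F F' : PhaseSpace n → ℝ} (hFc : Continuous F) (hF'c : Continuous F')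
    (hF : ∀ x, HasLineDerivAt ℝ F (F' x) x ((0, Pi.single i 1) : PhaseSpace n)) {A : ℝ}
    (hA : ∀ x, |F x| ≤ A * (1 + ‖x‖ ^ 2) ^ 2) (hA' : ∀ x, |F' x| ≤ A * (1 + ‖x‖ ^ 2) ^ 2)
    (hAp : ∀ x, |x.2 i * F x| ≤ A * (1 + ‖x‖ ^ 2) ^ 2) :
    ∫ x, x.2 i * F x ∂((pinnedChain ω₂ lam β γ).gibbsMeasure n T) =
      T * ∫ x, F' x ∂((pinnedChain ω₂ lam β γ).gibbsMeasure n T) := by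
  set P := pinnedChain ω₂ lam β γ with hP
  haveI : (volume : Measure (PhaseSpace n)).IsAddHaarMeasure :=
    @Measure.prod.instIsAddHaarMeasure (Fin n → ℝ) _ _ _ (Fin n → ℝ) _ _ _ volume volume _ _ _ _ _ _
  -- IBP: ∫ F · ∂_{p_i}ρ = -∫ F' ρ, with ∂_{p_i}ρ = -(p_i/T) ρ
  have hρ' : ∀ x, HasLineDerivAt ℝ (P.gibbsDensity n T) (-(x.2 i / T) * P.gibbsDensity n T x) x
      ((0, Pi.single i 1) : PhaseSpace n) := fun x =>
    P.hasLineDerivAt_gibbsDensity (P.hasLineDerivAt_hamiltonian_unitP n x i)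
  have hIF : Integrable (fun x => F x * P.gibbsDensity n T x) :=
    integrable_mul_gibbsDensity_of_growth hω hl hβ hT hFc hA
  have hIF' : Integrable (fun x => F' x * P.gibbsDensity n T x) :=
    integrable_mul_gibbsDensity_of_growth hω hl hβ hT hF'c hA'
  have hIFp : Integrable (fun x => x.2 i * F x * P.gibbsDensity n T x) :=
    integrable_mul_gibbsDensity_of_growth hω hl hβ hT ((by fun_prop : Continuous fun x : PhaseSpace n => x.2 i).mul hFc) hAp
  have e := integral_bilinear_hasLineDerivAt_right_eq_neg_left_of_integrable
    (μ := (volume : Measure (PhaseSpace n))) (B := ContinuousLinearMap.mul ℝ ℝ)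
    (f := F) (f' := F') (g := P.gibbsDensity n T) (g' := fun x => -(x.2 i / T) * P.gibbsDensity n T x)
    (v := ((0, Pi.single i 1) : PhaseSpace n)) ?_ ?_ ?_ (fun x _ => hF x) (fun x _ => hρ' x)
  · simp only [ContinuousLinearMap.mul_apply'] at e
    -- e : ∫ F x * (-(x.2 i / T) * ρ x) = -∫ F' x * ρ x
    have e2 : ∫ x, x.2 i * F x * P.gibbsDensity n T x = T * ∫ x, F' x * P.gibbsDensity n T x := by
      have e3 : ∫ x, F x * (-(x.2 i / T) * P.gibbsDensity n T x) =
          -(T⁻¹) * ∫ x, x.2 i * F x * P.gibbsDensity n T x := by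
        rw [← integral_const_mul]
        refine integral_congr_ae (Eventually.of_forall fun x => ?_)
        simp only [div_eq_mul_inv]
        ring
      rw [e3] at e
      have hT0 : T ≠ 0 := hT.ne'
      field_simp at e
      linarith
    rw [P.integral_gibbsMeasure, P.integral_gibbsMeasure (fun x => F' x), e2]
    ring
  · simp only [ContinuousLinearMap.mul_apply']
    exact hIF'
  · simp only [ContinuousLinearMap.mul_apply']
    have : (fun x => F x * (-(x.2 i / T) * P.gibbsDensity n T x)) =
        fun x => -(T⁻¹) * (x.2 i * F x * P.gibbsDensity n T x) := by
      funext x; simp only [div_eq_mul_inv]; ring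
    rw [this]
    exact hIFp.const_mul _
  · simp only [ContinuousLinearMap.mul_apply']
    exact hIF

end GibbsMoments


section Wick

/-- Powers up to four are dominated by `(1 + r²)²`. [folklore] -/
theorem pow_le_one_add_sq_sq {r : ℝ} (hr : 0 ≤ r) :
    r ≤ (1 + r ^ 2) ^ 2 ∧ r ^ 2 ≤ (1 + r ^ 2) ^ 2 ∧ r ^ 3 ≤ (1 + r ^ 2) ^ 2 ∧ r ^ 4 ≤ (1 + r ^ 2) ^ 2 := by
  refine ⟨?_, ?_, ?_, ?_⟩ <;> nlinarith [sq_nonneg (r - 1), sq_nonneg r, sq_nonneg (r ^ 2 - r), pow_nonneg hr 3, pow_nonneg hr 4]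


section GaussianMomenta

variable {ω₂ lam β γ : ℝ} (hω : 0 < ω₂) (hl : 0 ≤ lam) (hβ : 0 ≤ β) {n : ℕ} {T : ℝ} (hT : 0 < T)
include hω hl hβ hT

/-- **Equipartition** `∫ p_i² dμ_T = T` (Stein with `F = p_i`), for every chain of the family.
[folklore] -/
theorem gibbs_sq_momentum (i : Fin n) :
    ∫ x, x.2 i ^ 2 ∂((pinnedChain ω₂ lam β γ).gibbsMeasure n T) = T := by
  haveI : IsProbabilityMeasure ((pinnedChain ω₂ lam β γ).gibbsMeasure n T) :=
    pinnedChain_isProbabilityMeasure_gibbsMeasure hω hl hβ γ n hT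
  have hpc : Continuous fun x : PhaseSpace n => x.2 i := by fun_prop
  have hline : ∀ x : PhaseSpace n, HasLineDerivAt ℝ (fun x : PhaseSpace n => x.2 i) 1 x
      ((0, Pi.single i 1) : PhaseSpace n) := by
    intro x
    unfold HasLineDerivAt
    have key : (fun s : ℝ => (fun x : PhaseSpace n => x.2 i) (x + s • ((0, Pi.single i 1) : PhaseSpace n))) =
        fun s => x.2 i + s := by
      funext s
      simp
    rw [key]
    exact (hasDerivAt_id (0 : ℝ)).const_add _
  have hA1 : ∀ x : PhaseSpace n, |x.2 i| ≤ 1 * (1 + ‖x‖ ^ 2) ^ 2 := fun x => by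
    have h1 := OscillatorChain.abs_snd_apply_le_norm x i
    have h2 := (pow_le_one_add_sq_sq (norm_nonneg x)).1
    linarith
  have hA2 : ∀ x : PhaseSpace n, |(1 : ℝ)| ≤ 1 * (1 + ‖x‖ ^ 2) ^ 2 := fun x => by
    rw [abs_one]; nlinarith [norm_nonneg x]
  have hA3 : ∀ x : PhaseSpace n, |x.2 i * x.2 i| ≤ 1 * (1 + ‖x‖ ^ 2) ^ 2 := fun x => by
    have h1 := OscillatorChain.abs_snd_apply_le_norm x i
    have h2 := (pow_le_one_add_sq_sq (norm_nonneg x)).2.1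
    rw [abs_mul]
    calc |x.2 i| * |x.2 i| ≤ ‖x‖ * ‖x‖ := mul_le_mul h1 h1 (abs_nonneg _) (norm_nonneg _)
      _ ≤ 1 * (1 + ‖x‖ ^ 2) ^ 2 := by nlinarith
  have h := stein_momentum (γ := γ) hω hl hβ hT i (F := fun x => x.2 i) (F' := fun _ => (1 : ℝ))
    hpc continuous_const hline (A := 1) hA1 hA2 hA3
  rw [integral_const, probReal_univ, one_smul, mul_one] at h
  calc ∫ x, x.2 i ^ 2 ∂((pinnedChain ω₂ lam β γ).gibbsMeasure n T)
      = ∫ x, x.2 i * x.2 i ∂((pinnedChain ω₂ lam β γ).gibbsMeasure n T) :=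
        integral_congr_ae (Eventually.of_forall fun x => pow_two (x.2 i))
    _ = T := h

/-- **Stein with a linear observable**: `∫ p_i L dμ_T = T · L(e_{p_i})` for a continuous linear
functional `L`. [folklore] -/
theorem gibbs_momentum_mul_clm (i : Fin n) (L : PhaseSpace n →L[ℝ] ℝ) :
    ∫ x, x.2 i * L x ∂((pinnedChain ω₂ lam β γ).gibbsMeasure n T) =
      T * L ((0, Pi.single i 1) : PhaseSpace n) := by
  haveI : IsProbabilityMeasure ((pinnedChain ω₂ lam β γ).gibbsMeasure n T) :=
    pinnedChain_isProbabilityMeasure_gibbsMeasure hω hl hβ γ n hT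
  set G := ‖L‖ with hG
  set g₀ := L ((0, Pi.single i 1) : PhaseSpace n) with hg₀
  have hgb : ∀ x, |L x| ≤ G * ‖x‖ := fun x => by
    have := L.le_opNorm x; rwa [Real.norm_eq_abs] at this
  have hline : ∀ x, HasLineDerivAt ℝ (fun x => L x) g₀ x ((0, Pi.single i 1) : PhaseSpace n) := fun x =>
    (L.hasFDerivAt).hasLineDerivAt _
  have hpc : Continuous fun x : PhaseSpace n => x.2 i := by fun_prop
  have hA1 : ∀ x : PhaseSpace n, |L x| ≤ max G |g₀| * (1 + ‖x‖ ^ 2) ^ 2 := fun x => by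
    have h2 := (pow_le_one_add_sq_sq (norm_nonneg x)).1
    calc |L x| ≤ G * ‖x‖ := hgb x
      _ ≤ max G |g₀| * (1 + ‖x‖ ^ 2) ^ 2 :=
          mul_le_mul (le_max_left _ _) h2 (norm_nonneg _) (le_trans (norm_nonneg L) (le_max_left _ _))
  have hA2 : ∀ x : PhaseSpace n, |g₀| ≤ max G |g₀| * (1 + ‖x‖ ^ 2) ^ 2 := fun x => by
    have h1 : (1 : ℝ) ≤ (1 + ‖x‖ ^ 2) ^ 2 := by nlinarith [norm_nonneg x]
    calc |g₀| = |g₀| * 1 := by ring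
      _ ≤ max G |g₀| * (1 + ‖x‖ ^ 2) ^ 2 :=
          mul_le_mul (le_max_right _ _) h1 zero_le_one (le_trans (abs_nonneg _) (le_max_right _ _))
  have hA3 : ∀ x : PhaseSpace n, |x.2 i * L x| ≤ max G |g₀| * (1 + ‖x‖ ^ 2) ^ 2 := fun x => by
    have h1 := OscillatorChain.abs_snd_apply_le_norm x i
    have h4 := (pow_le_one_add_sq_sq (norm_nonneg x)).2.1
    rw [abs_mul]
    calc |x.2 i| * |L x| ≤ ‖x‖ * (G * ‖x‖) := mul_le_mul h1 (hgb x) (abs_nonneg _) (norm_nonneg _)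
      _ = G * ‖x‖ ^ 2 := by ring
      _ ≤ max G |g₀| * (1 + ‖x‖ ^ 2) ^ 2 :=
          mul_le_mul (le_max_left _ _) h4 (by positivity) (le_trans (norm_nonneg L) (le_max_left _ _))
  have h := stein_momentum (γ := γ) hω hl hβ hT i (F := fun x => L x) (F' := fun _ => g₀)
    L.continuous continuous_const hline hA1 hA2 hA3
  rw [integral_const, probReal_univ, one_smul] at h
  exact h

/-- **The Gaussian (Wick) pair identity of the Gibbs measure**: for a continuous linear functional
`L`, `∫ p_i² L² dμ_T = T ∫ L² dμ_T + 2 (∫ p_i L dμ_T)²` (Stein with `F = p_i L²`), for every chain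
of the family — momenta are exactly Gaussian and independent of positions. [folklore] -/
theorem gibbs_sq_momentum_mul_clm_sq (i : Fin n) (L : PhaseSpace n →L[ℝ] ℝ) :
    ∫ x, x.2 i ^ 2 * L x ^ 2 ∂((pinnedChain ω₂ lam β γ).gibbsMeasure n T) =
      T * ∫ x, L x ^ 2 ∂((pinnedChain ω₂ lam β γ).gibbsMeasure n T) +
        2 * (∫ x, x.2 i * L x ∂((pinnedChain ω₂ lam β γ).gibbsMeasure n T)) ^ 2 := by
  set μ := (pinnedChain ω₂ lam β γ).gibbsMeasure n T with hμ
  set G := ‖L‖ with hG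
  set v₀ : PhaseSpace n := (0, Pi.single i 1) with hv₀
  set g₀ := L v₀ with hg₀
  have hgb : ∀ x, |L x| ≤ G * ‖x‖ := fun x => by
    have := L.le_opNorm x; rwa [Real.norm_eq_abs] at this
  have hpc : Continuous fun x : PhaseSpace n => x.2 i := by fun_prop
  have hLc : Continuous fun x : PhaseSpace n => L x := L.continuous
  -- the line derivative of `p_i L²`
  have hline : ∀ x : PhaseSpace n, HasLineDerivAt ℝ (fun x : PhaseSpace n => x.2 i * L x ^ 2)
      (L x ^ 2 + 2 * x.2 i * L x * g₀) x v₀ := by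
    intro x
    unfold HasLineDerivAt
    have key : (fun s : ℝ => (fun x : PhaseSpace n => x.2 i * L x ^ 2) (x + s • v₀)) =
        fun s => (x.2 i + s) * (L x + s * g₀) ^ 2 := by
      funext s
      simp only [map_add, map_smul, smul_eq_mul, hv₀, Prod.snd_add, Prod.smul_snd, Pi.add_apply,
        Pi.smul_apply, Pi.single_eq_same, mul_one]
      ring
    rw [key]
    have h1 : HasDerivAt (fun s : ℝ => x.2 i + s) 1 0 := (hasDerivAt_id (0 : ℝ)).const_add _
    have h2 : HasDerivAt (fun s : ℝ => L x + s * g₀) (1 * g₀) 0 := ((hasDerivAt_id (0 : ℝ)).mul_const g₀).const_add _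
    have h4 := h1.mul (h2.pow 2)
    refine h4.congr_deriv ?_
    norm_num
    ring
  -- growth bounds
  set A : ℝ := G ^ 2 + 2 * |g₀| * G with hA
  have hG0 : 0 ≤ G := norm_nonneg _
  have hA1 : ∀ x : PhaseSpace n, |x.2 i * L x ^ 2| ≤ A * (1 + ‖x‖ ^ 2) ^ 2 := fun x => by
    have h1 := OscillatorChain.abs_snd_apply_le_norm x i
    have h5 := (pow_le_one_add_sq_sq (norm_nonneg x)).2.2.1
    rw [abs_mul, abs_pow]
    have e2 : |L x| ^ 2 ≤ (G * ‖x‖) ^ 2 := pow_le_pow_left₀ (abs_nonneg _) (hgb x) 2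
    have hpos : 0 ≤ 2 * |g₀| * G * (1 + ‖x‖ ^ 2) ^ 2 := by positivity
    calc |x.2 i| * |L x| ^ 2 ≤ ‖x‖ * (G * ‖x‖) ^ 2 := mul_le_mul h1 e2 (by positivity) (norm_nonneg _)
      _ = G ^ 2 * ‖x‖ ^ 3 := by ring
      _ ≤ G ^ 2 * (1 + ‖x‖ ^ 2) ^ 2 := by nlinarith [sq_nonneg G]
      _ ≤ A * (1 + ‖x‖ ^ 2) ^ 2 := by rw [hA]; nlinarith
  have hA2 : ∀ x : PhaseSpace n, |L x ^ 2 + 2 * x.2 i * L x * g₀| ≤ A * (1 + ‖x‖ ^ 2) ^ 2 := fun x => by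
    have h1 := OscillatorChain.abs_snd_apply_le_norm x i
    have h4 := (pow_le_one_add_sq_sq (norm_nonneg x)).2.1
    have e1 : |L x ^ 2| ≤ G ^ 2 * (1 + ‖x‖ ^ 2) ^ 2 := by
      rw [abs_pow]
      calc |L x| ^ 2 ≤ (G * ‖x‖) ^ 2 := pow_le_pow_left₀ (abs_nonneg _) (hgb x) 2
        _ = G ^ 2 * ‖x‖ ^ 2 := by ring
        _ ≤ G ^ 2 * (1 + ‖x‖ ^ 2) ^ 2 := by nlinarith [sq_nonneg G]
    have e2 : |x.2 i * L x| ≤ G * (1 + ‖x‖ ^ 2) ^ 2 := by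
      rw [abs_mul]
      calc |x.2 i| * |L x| ≤ ‖x‖ * (G * ‖x‖) := mul_le_mul h1 (hgb x) (abs_nonneg _) (norm_nonneg _)
        _ = G * ‖x‖ ^ 2 := by ring
        _ ≤ G * (1 + ‖x‖ ^ 2) ^ 2 := by nlinarith
    calc |L x ^ 2 + 2 * x.2 i * L x * g₀| ≤ |L x ^ 2| + |2 * x.2 i * L x * g₀| := abs_add_le _ _
      _ = |L x ^ 2| + 2 * |g₀| * |x.2 i * L x| := by
          rw [show 2 * x.2 i * L x * g₀ = (2 * g₀) * (x.2 i * L x) by ring, abs_mul, abs_mul, abs_two]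
      _ ≤ G ^ 2 * (1 + ‖x‖ ^ 2) ^ 2 + 2 * |g₀| * (G * (1 + ‖x‖ ^ 2) ^ 2) := by gcongr
      _ = A * (1 + ‖x‖ ^ 2) ^ 2 := by rw [hA]; ring
  have hA3 : ∀ x : PhaseSpace n, |x.2 i * (x.2 i * L x ^ 2)| ≤ A * (1 + ‖x‖ ^ 2) ^ 2 := fun x => by
    have h1 := OscillatorChain.abs_snd_apply_le_norm x i
    have h6 := (pow_le_one_add_sq_sq (norm_nonneg x)).2.2.2
    rw [show x.2 i * (x.2 i * L x ^ 2) = x.2 i ^ 2 * L x ^ 2 by ring, abs_mul, abs_pow, abs_pow]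
    have e1 : |x.2 i| ^ 2 ≤ ‖x‖ ^ 2 := pow_le_pow_left₀ (abs_nonneg _) h1 2
    have e2 : |L x| ^ 2 ≤ (G * ‖x‖) ^ 2 := pow_le_pow_left₀ (abs_nonneg _) (hgb x) 2
    have hpos : 0 ≤ 2 * |g₀| * G * (1 + ‖x‖ ^ 2) ^ 2 := by positivity
    calc |x.2 i| ^ 2 * |L x| ^ 2 ≤ ‖x‖ ^ 2 * (G * ‖x‖) ^ 2 := mul_le_mul e1 e2 (by positivity) (by positivity)
      _ = G ^ 2 * ‖x‖ ^ 4 := by ring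
      _ ≤ G ^ 2 * (1 + ‖x‖ ^ 2) ^ 2 := by nlinarith [sq_nonneg G]
      _ ≤ A * (1 + ‖x‖ ^ 2) ^ 2 := by rw [hA]; nlinarith
  have hS3 := stein_momentum (γ := γ) hω hl hβ hT i (F := fun x => x.2 i * L x ^ 2)
    (F' := fun x => L x ^ 2 + 2 * x.2 i * L x * g₀) (hpc.mul (hLc.pow 2)) (by fun_prop) hline hA1 hA2 hA3
  -- integrability of `L²` and `p_i L`
  have hI_gg : Integrable (fun x : PhaseSpace n => L x ^ 2) μ := by
    refine integrable_gibbsMeasure_of_growth hω hl hβ hT (hLc.pow 2) (A := G ^ 2) fun x => ?_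
    rw [abs_pow]
    have h4 := (pow_le_one_add_sq_sq (norm_nonneg x)).2.1
    calc |L x| ^ 2 ≤ (G * ‖x‖) ^ 2 := pow_le_pow_left₀ (abs_nonneg _) (hgb x) 2
      _ = G ^ 2 * ‖x‖ ^ 2 := by ring
      _ ≤ G ^ 2 * (1 + ‖x‖ ^ 2) ^ 2 := by nlinarith [sq_nonneg G]
  have hI_pg : Integrable (fun x : PhaseSpace n => x.2 i * L x) μ := by
    refine integrable_gibbsMeasure_of_growth hω hl hβ hT (hpc.mul hLc) (A := G) fun x => ?_
    have h1 := OscillatorChain.abs_snd_apply_le_norm x i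
    have h4 := (pow_le_one_add_sq_sq (norm_nonneg x)).2.1
    rw [abs_mul]
    calc |x.2 i| * |L x| ≤ ‖x‖ * (G * ‖x‖) := mul_le_mul h1 (hgb x) (abs_nonneg _) (norm_nonneg _)
      _ = G * ‖x‖ ^ 2 := by ring
      _ ≤ G * (1 + ‖x‖ ^ 2) ^ 2 := by nlinarith
  have hS1 : ∫ x, x.2 i * L x ∂μ = T * g₀ := gibbs_momentum_mul_clm hω hl hβ hT i L
  have e1 : ∫ x, x.2 i ^ 2 * L x ^ 2 ∂μ = ∫ x, x.2 i * (x.2 i * L x ^ 2) ∂μ :=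
    integral_congr_ae (Eventually.of_forall fun x => by simp only; ring)
  have hI1 : Integrable (fun x : PhaseSpace n => 2 * g₀ * (x.2 i * L x)) μ := hI_pg.const_mul _
  have e2 : ∫ x, (L x ^ 2 + 2 * x.2 i * L x * g₀) ∂μ = (∫ x, L x ^ 2 ∂μ) + 2 * g₀ * ∫ x, x.2 i * L x ∂μ := by
    have : (fun x : PhaseSpace n => L x ^ 2 + 2 * x.2 i * L x * g₀) =
        fun x => L x ^ 2 + 2 * g₀ * (x.2 i * L x) := funext fun x => by ring
    rw [this, integral_add hI_gg hI1, integral_const_mul]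
  rw [e1, hS3, e2, hS1]
  ring

end GaussianMomenta

variable {ω₂ γ : ℝ} (hω : 0 < ω₂) (hγ : 0 ≤ γ) {T : ℝ} (hT : 0 < T)
include hω hγ hT

/-- **THE WICK IDENTITY OF THE HARMONIC CORNER, PROVED**: for the pinned HARMONIC chain
(`lam = β = 0`, `ω₂ > 0`, `γ ≥ 0`, `T > 0`) started in its Gibbs state, `C_N(t) = 2 r_N(t)²` for
every `N` and `t` — the connected four-point (cumulant) channel is EMPTY. Ingredients: superposition
for the constructed pathwise flow (`M_t` linear, kernel from `x` = translate of the kernel from rest),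
the CEHR (3.4) moment bound for the constructed kernels, reflection symmetry, and Stein's identity in
the `p₀` direction for the Gibbs measure (momenta exactly Gaussian). [cite: RiederLebowitzLieb1967] -/
theorem harmonicWick_holds : HarmonicWick ω₂ γ T := by
  intro N t _ht
  have hn : 0 < N + 1 := Nat.succ_pos N
  set P := pinnedChain ω₂ 0 0 γ with hP
  set τ : ℝ≥0 := t.toNNReal with hτ
  set μ := P.gibbsMeasure (N + 1) T with hμ
  haveI : IsProbabilityMeasure μ := pinnedChain_isProbabilityMeasure_gibbsMeasure hω le_rfl le_rfl γ (N + 1) hT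
  -- the deterministic flow is linear; g = p_N ∘ M_τ as a continuous linear functional
  obtain ⟨M, hM⟩ := harmonic_chainFlow_zero_noise_linear hω hγ (N + 1) (τ : ℝ)
  set gL : PhaseSpace (N + 1) →L[ℝ] ℝ :=
    LinearMap.toContinuousLinearMap (((LinearMap.proj (Fin.last N)).comp (LinearMap.snd ℝ _ _)).comp M) with hgL
  have hg : ∀ x, gL x = (M x).2 (Fin.last N) := fun x => rfl
  set G := ‖gL‖ with hG
  have hgb : ∀ x, |gL x| ≤ G * ‖x‖ := fun x => by
    have := gL.le_opNorm x; rwa [Real.norm_eq_abs] at this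
  -- kernel moments at rest, and the kernel action on `p_N`, `p_N²`
  set m : ℝ := ∫ y, y.2 (Fin.last N) ∂(P.transitionKernel (N + 1) T T τ 0) with hm
  set w : ℝ := ∫ y, y.2 (Fin.last N) ^ 2 ∂(P.transitionKernel (N + 1) T T τ 0) with hw
  have hK1 : ∀ z : PhaseSpace (N + 1),
      ∫ y, y.2 (Fin.last N) ∂(P.transitionKernel (N + 1) T T τ z) = gL z + m := by
    intro z
    rw [harmonic_kernel_momentum hω hγ hn hT τ z (Fin.last N), hM z, hg]
  have hK2 : ∀ z : PhaseSpace (N + 1),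
      ∫ y, y.2 (Fin.last N) ^ 2 ∂(P.transitionKernel (N + 1) T T τ z) = gL z ^ 2 + 2 * gL z * m + w := by
    intro z
    rw [harmonic_kernel_momentum_sq hω hγ hn hT τ z (Fin.last N), hM z, hg]
  have hgc : Continuous fun x : PhaseSpace (N + 1) => gL x := gL.continuous
  have hpc : Continuous fun x : PhaseSpace (N + 1) => x.2 (0 : Fin (N + 1)) := by fun_prop
  -- integrability under μ (growth bounds)
  have hI_p : Integrable (fun x : PhaseSpace (N + 1) => x.2 0) μ := by
    refine integrable_gibbsMeasure_of_growth hω le_rfl le_rfl hT hpc (A := 1) fun x => ?_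
    have h1 := OscillatorChain.abs_snd_apply_le_norm x 0
    have h2 := (pow_le_one_add_sq_sq (norm_nonneg x)).1
    linarith
  have hI_g : Integrable (fun x : PhaseSpace (N + 1) => gL x) μ := by
    refine integrable_gibbsMeasure_of_growth hω le_rfl le_rfl hT hgc (A := G) fun x => ?_
    have h2 := (pow_le_one_add_sq_sq (norm_nonneg x)).1
    calc |gL x| ≤ G * ‖x‖ := hgb x
      _ ≤ G * (1 + ‖x‖ ^ 2) ^ 2 := by nlinarith [norm_nonneg gL]
  have hI_pg : Integrable (fun x : PhaseSpace (N + 1) => x.2 0 * gL x) μ := by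
    refine integrable_gibbsMeasure_of_growth hω le_rfl le_rfl hT (hpc.mul hgc) (A := G) fun x => ?_
    have h1 := OscillatorChain.abs_snd_apply_le_norm x 0
    have h4 := (pow_le_one_add_sq_sq (norm_nonneg x)).2.1
    rw [abs_mul]
    calc |x.2 0| * |gL x| ≤ ‖x‖ * (G * ‖x‖) := mul_le_mul h1 (hgb x) (abs_nonneg _) (norm_nonneg _)
      _ = G * ‖x‖ ^ 2 := by ring
      _ ≤ G * (1 + ‖x‖ ^ 2) ^ 2 := by nlinarith [norm_nonneg gL]
  have hI_pp : Integrable (fun x : PhaseSpace (N + 1) => x.2 0 ^ 2) μ := by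
    refine integrable_gibbsMeasure_of_growth hω le_rfl le_rfl hT (hpc.pow 2) (A := 1) fun x => ?_
    have h1 := OscillatorChain.abs_snd_apply_le_norm x 0
    have h4 := (pow_le_one_add_sq_sq (norm_nonneg x)).2.1
    rw [abs_pow]
    calc |x.2 0| ^ 2 ≤ ‖x‖ ^ 2 := pow_le_pow_left₀ (abs_nonneg _) h1 2
      _ ≤ 1 * (1 + ‖x‖ ^ 2) ^ 2 := by linarith
  have hI_gg : Integrable (fun x : PhaseSpace (N + 1) => gL x ^ 2) μ := by
    refine integrable_gibbsMeasure_of_growth hω le_rfl le_rfl hT (hgc.pow 2) (A := G ^ 2) fun x => ?_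
    rw [abs_pow]
    have h4 := (pow_le_one_add_sq_sq (norm_nonneg x)).2.1
    calc |gL x| ^ 2 ≤ (G * ‖x‖) ^ 2 := pow_le_pow_left₀ (abs_nonneg _) (hgb x) 2
      _ = G ^ 2 * ‖x‖ ^ 2 := by ring
      _ ≤ G ^ 2 * (1 + ‖x‖ ^ 2) ^ 2 := by nlinarith [sq_nonneg G]
  have hI_ppg : Integrable (fun x : PhaseSpace (N + 1) => x.2 0 ^ 2 * gL x) μ := by
    refine integrable_gibbsMeasure_of_growth hω le_rfl le_rfl hT ((hpc.pow 2).mul hgc) (A := G) fun x => ?_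
    have h1 := OscillatorChain.abs_snd_apply_le_norm x 0
    have h5 := (pow_le_one_add_sq_sq (norm_nonneg x)).2.2.1
    rw [abs_mul, abs_pow]
    have e1 : |x.2 0| ^ 2 ≤ ‖x‖ ^ 2 := pow_le_pow_left₀ (abs_nonneg _) h1 2
    calc |x.2 0| ^ 2 * |gL x| ≤ ‖x‖ ^ 2 * (G * ‖x‖) := mul_le_mul e1 (hgb x) (abs_nonneg _) (by positivity)
      _ = G * ‖x‖ ^ 3 := by ring
      _ ≤ G * (1 + ‖x‖ ^ 2) ^ 2 := by nlinarith [norm_nonneg gL]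
  have hI_ppgg : Integrable (fun x : PhaseSpace (N + 1) => x.2 0 ^ 2 * gL x ^ 2) μ := by
    refine integrable_gibbsMeasure_of_growth hω le_rfl le_rfl hT ((hpc.pow 2).mul (hgc.pow 2)) (A := G ^ 2) fun x => ?_
    have h1 := OscillatorChain.abs_snd_apply_le_norm x 0
    have h6 := (pow_le_one_add_sq_sq (norm_nonneg x)).2.2.2
    rw [abs_mul, abs_pow, abs_pow]
    have e1 : |x.2 0| ^ 2 ≤ ‖x‖ ^ 2 := pow_le_pow_left₀ (abs_nonneg _) h1 2
    have e2 : |gL x| ^ 2 ≤ (G * ‖x‖) ^ 2 := pow_le_pow_left₀ (abs_nonneg _) (hgb x) 2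
    calc |x.2 0| ^ 2 * |gL x| ^ 2 ≤ ‖x‖ ^ 2 * (G * ‖x‖) ^ 2 := mul_le_mul e1 e2 (by positivity) (by positivity)
      _ = G ^ 2 * ‖x‖ ^ 4 := by ring
      _ ≤ G ^ 2 * (1 + ‖x‖ ^ 2) ^ 2 := by nlinarith [sq_nonneg G]
  -- odd moments vanish (reflection symmetry)
  have hodd_p : ∫ x, x.2 (0 : Fin (N + 1)) ∂μ = 0 :=
    integral_gibbsMeasure_eq_zero_of_odd (N + 1) T (fun x => by simp)
  have hodd_g : ∫ x, gL x ∂μ = 0 :=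
    integral_gibbsMeasure_eq_zero_of_odd (N + 1) T (fun x => by simp)
  have hodd_ppg : ∫ x, x.2 (0 : Fin (N + 1)) ^ 2 * gL x ∂μ = 0 :=
    integral_gibbsMeasure_eq_zero_of_odd (N + 1) T (fun x => by simp)
  -- Gaussian facts of the Gibbs measure
  have hp2 : ∫ x, x.2 (0 : Fin (N + 1)) ^ 2 ∂μ = T := gibbs_sq_momentum hω le_rfl le_rfl hT 0
  have h4 : ∫ x, x.2 0 ^ 2 * gL x ^ 2 ∂μ = T * ∫ x, gL x ^ 2 ∂μ + 2 * (∫ x, x.2 0 * gL x ∂μ) ^ 2 :=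
    gibbs_sq_momentum_mul_clm_sq hω le_rfl le_rfl hT 0 gL
  -- the crux integrands at lam = β = 0
  have er : rN ω₂ 0 0 γ T N t = ∫ x, x.2 0 * gL x ∂μ := by
    unfold rN
    rw [← hP, ← hτ, ← hμ]
    simp_rw [hK1]
    have : (fun z : PhaseSpace (N + 1) => z.2 0 * (gL z + m)) = fun z => z.2 0 * gL z + m * z.2 0 :=
      funext fun z => by ring
    rw [this, integral_add hI_pg (hI_p.const_mul m), integral_const_mul, hodd_p, mul_zero, add_zero]
  have eC : CN ω₂ 0 0 γ T N t = ∫ x, x.2 0 ^ 2 * gL x ^ 2 ∂μ - T * ∫ x, gL x ^ 2 ∂μ := by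
    unfold CN
    rw [← hP, ← hτ, ← hμ]
    simp_rw [hK2]
    have e1 : (fun z : PhaseSpace (N + 1) => z.2 0 ^ 2 * (gL z ^ 2 + 2 * gL z * m + w)) =
        fun z => (z.2 0 ^ 2 * gL z ^ 2 + 2 * m * (z.2 0 ^ 2 * gL z)) + w * z.2 0 ^ 2 := funext fun z => by ring
    have e2 : (fun z : PhaseSpace (N + 1) => gL z ^ 2 + 2 * gL z * m + w) =
        fun z => (gL z ^ 2 + 2 * m * gL z) + w := funext fun z => by ring
    have hI1 : Integrable (fun z : PhaseSpace (N + 1) => z.2 0 ^ 2 * gL z ^ 2 + 2 * m * (z.2 0 ^ 2 * gL z)) μ :=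
      hI_ppgg.add (hI_ppg.const_mul _)
    have hI2 : Integrable (fun z : PhaseSpace (N + 1) => w * z.2 0 ^ 2) μ := hI_pp.const_mul w
    have hI3 : Integrable (fun z : PhaseSpace (N + 1) => 2 * m * (z.2 0 ^ 2 * gL z)) μ := hI_ppg.const_mul _
    have hI4 : Integrable (fun z : PhaseSpace (N + 1) => gL z ^ 2 + 2 * m * gL z) μ := hI_gg.add (hI_g.const_mul _)
    have hI5 : Integrable (fun z : PhaseSpace (N + 1) => 2 * m * gL z) μ := hI_g.const_mul _
    rw [e1, e2, integral_add hI1 hI2, integral_add hI_ppgg hI3, integral_add hI4 (integrable_const w),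
      integral_add hI_gg hI5, integral_const_mul, integral_const_mul, integral_const_mul,
      integral_const, probReal_univ, one_smul, hodd_ppg, hodd_g, hp2]
    ring
  rw [eC, er, h4]
  ring


/-- **Classical fluctuation–dissipation for the harmonic chain, PROVED**: `r_N(t) = T · G_N(t)` where
`G_N(t) = (Φ_t(e_{p₀}, 0))_{p_N}` is the deterministic impulse response of `p_N` to a unit kick on
`p₀` (the constructed flow from `(0, e₀)` with zero noise). Hence (Wick) `C_N(t) = 2T² G_N(t)²`, and
support item `HarmonicCoherentPersistence` (stmt-11814) is the statement `N ∫₀^∞ G_N² ↛ 0` about the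
damped harmonic lattice alone. [cite: RiederLebowitzLieb1967] -/
theorem harmonic_rN_eq_response (N : ℕ) (t : ℝ) :
    rN ω₂ 0 0 γ T N t =
      T * ((pinnedChain ω₂ 0 0 γ).chainFlow (N + 1) ((0, Pi.single 0 1) : PhaseSpace (N + 1)) 0
        (t.toNNReal : ℝ)).2 (Fin.last N) := by
  have hn : 0 < N + 1 := Nat.succ_pos N
  set P := pinnedChain ω₂ 0 0 γ with hP
  set τ : ℝ≥0 := t.toNNReal with hτ
  set μ := P.gibbsMeasure (N + 1) T with hμ
  haveI : IsProbabilityMeasure μ := pinnedChain_isProbabilityMeasure_gibbsMeasure hω le_rfl le_rfl γ (N + 1) hT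
  obtain ⟨M, hM⟩ := harmonic_chainFlow_zero_noise_linear hω hγ (N + 1) (τ : ℝ)
  set gL : PhaseSpace (N + 1) →L[ℝ] ℝ :=
    LinearMap.toContinuousLinearMap (((LinearMap.proj (Fin.last N)).comp (LinearMap.snd ℝ _ _)).comp M) with hgL
  have hg : ∀ x, gL x = (M x).2 (Fin.last N) := fun x => rfl
  set G := ‖gL‖ with hG
  have hgb : ∀ x, |gL x| ≤ G * ‖x‖ := fun x => by
    have := gL.le_opNorm x; rwa [Real.norm_eq_abs] at this
  set m : ℝ := ∫ y, y.2 (Fin.last N) ∂(P.transitionKernel (N + 1) T T τ 0) with hm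
  have hK1 : ∀ z : PhaseSpace (N + 1),
      ∫ y, y.2 (Fin.last N) ∂(P.transitionKernel (N + 1) T T τ z) = gL z + m := by
    intro z
    rw [harmonic_kernel_momentum hω hγ hn hT τ z (Fin.last N), hM z, hg]
  have hgc : Continuous fun x : PhaseSpace (N + 1) => gL x := gL.continuous
  have hpc : Continuous fun x : PhaseSpace (N + 1) => x.2 (0 : Fin (N + 1)) := by fun_prop
  have hI_p : Integrable (fun x : PhaseSpace (N + 1) => x.2 0) μ := by
    refine integrable_gibbsMeasure_of_growth hω le_rfl le_rfl hT hpc (A := 1) fun x => ?_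
    have h1 := OscillatorChain.abs_snd_apply_le_norm x 0
    have h2 := (pow_le_one_add_sq_sq (norm_nonneg x)).1
    linarith
  have hI_pg : Integrable (fun x : PhaseSpace (N + 1) => x.2 0 * gL x) μ := by
    refine integrable_gibbsMeasure_of_growth hω le_rfl le_rfl hT (hpc.mul hgc) (A := G) fun x => ?_
    have h1 := OscillatorChain.abs_snd_apply_le_norm x 0
    have h4 := (pow_le_one_add_sq_sq (norm_nonneg x)).2.1
    rw [abs_mul]
    calc |x.2 0| * |gL x| ≤ ‖x‖ * (G * ‖x‖) := mul_le_mul h1 (hgb x) (abs_nonneg _) (norm_nonneg _)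
      _ = G * ‖x‖ ^ 2 := by ring
      _ ≤ G * (1 + ‖x‖ ^ 2) ^ 2 := by nlinarith [norm_nonneg gL]
  have hodd_p : ∫ x, x.2 (0 : Fin (N + 1)) ∂μ = 0 :=
    integral_gibbsMeasure_eq_zero_of_odd (N + 1) T (fun x => by simp)
  have er : rN ω₂ 0 0 γ T N t = ∫ x, x.2 0 * gL x ∂μ := by
    unfold rN
    rw [← hP, ← hτ, ← hμ]
    simp_rw [hK1]
    have : (fun z : PhaseSpace (N + 1) => z.2 0 * (gL z + m)) = fun z => z.2 0 * gL z + m * z.2 0 :=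
      funext fun z => by ring
    rw [this, integral_add hI_pg (hI_p.const_mul m), integral_const_mul, hodd_p, mul_zero, add_zero]
  rw [er, gibbs_momentum_mul_clm hω le_rfl le_rfl hT 0 gL, hg, ← hM]

/-- Hence `C_N(t) = 2 T² G_N(t)²` for the harmonic chain. [cite: RiederLebowitzLieb1967] -/
theorem harmonic_CN_eq_response_sq (N : ℕ) (t : ℝ) (ht : 0 < t) :
    CN ω₂ 0 0 γ T N t =
      2 * T ^ 2 * ((pinnedChain ω₂ 0 0 γ).chainFlow (N + 1) ((0, Pi.single 0 1) : PhaseSpace (N + 1)) 0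
        (t.toNNReal : ℝ)).2 (Fin.last N) ^ 2 := by
  rw [harmonicWick_holds hω hγ hT N t ht, harmonic_rN_eq_response hω hγ hT N t]
  ring

/-- **`lam > 0 ∨ β > 0` IS LOAD-BEARING — unconditionally.** With the harmonic corner admitted the
crux is FALSE: the cumulant channel of the Gaussian chain vanishes identically, `a_N ≡ 0 ↛ κ > 0`.
Any proof of `IncoherentChannel` must use anharmonicity in an essential, non-perturbative way, and by
§4 nothing uniform as `T → 0⁺` can hold. [folklore] -/
theorem cruxWithoutAnharmonicity_false (hγ' : 0 < γ) : ¬ CruxWithoutAnharmonicity :=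
  cruxWithoutAnharmonicity_false_of_wick hω hγ' hT (harmonicWick_holds hω hγ hT)

/-- The harmonic chain is NOT a model of the crux's conclusion, at any admissible `(ω₂, γ, T)`.
[folklore] -/
theorem not_At_harmonic : ¬ At ω₂ 0 0 γ T :=
  not_At_harmonic_of_wick (harmonicWick_holds hω hγ hT)

end Wick

/-- The crux itself in unit-temperature normal form. [folklore] -/
theorem incoherentChannel_iff_unit_temperature :
    IncoherentChannel ↔ ∀ ω₂ lam β γ : ℝ, 0 < ω₂ → 0 < lam → 0 < β → 0 < γ → At ω₂ lam β γ 1 :=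
  incoherentChannel_iff.trans crux_iff_unit_temperature


/-! ## §6 (gen 3, cycle 1) The live line `two-horizons-forecast-loss`: load-bearing hypotheses of its two
OPEN stubs, their unit-temperature normal form, why the line resists, and what its engine must deliver

Vocabulary of the line (landed route Defs `Theorems/PhononMeanFreePathDefs.lean`): `fcast` (`v_t = K_t p_N`),
`fnorm` (`S_N = ‖v_t‖²_{L²(μ_T)}`), `pairCorr` (`= rN` here, `rfl`), `commonPast` (`P_N = Cov(p_0², v_t²)`),
`powerCov` (`= CN` here, `rfl`), `varianceChannel` (`B_N = C_N − P_N = Cov(p_0², Var(p_N(t)|z))`).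
OPEN stubs (registered by the lead, `ledger workitem stubs`): the ENGINE
`stub_forecastLoss : ∀ params > 0, ∀ T > 0, ∃ C α, 2 < α ∧ ∀ N t, 0 ≤ t → fnorm … N t ≤ C (1+t)^(-α)` and the
TRANSPORT CORE `stub_varianceLimit : ∀ params > 0, ∀ T > 0, ∃ κ > 0, N(γ²/T²)∫_{t>0} varianceChannel … N t → κ`.
Landed as `Theorems/IncoherentChannel/Negative/{ForecastLossGammaZero, VarianceLimitHarmonic, LineScaling,
LineResistance}.lean` (proposals of this cycle; see the census in the module docstring). -/

open Summit.AtomisticToContinuum.FouriersLaw.Theorems.PhononMeanFreePath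
open Summit.AtomisticToContinuum.FouriersLaw.Theorems.SubdiffusiveBondHeat
  (pinnedChain_integral_transitionKernel_gibbsMeasure)
open Summit.AtomisticToContinuum.FouriersLaw.Theorems.PhononMeanFreePathBoundaryKubo (boundaryKubo_proof)

/-- The line's `pairCorr` IS this file's `rN`, and its `powerCov` IS this file's `CN` (definitional). [folklore] -/
theorem pairCorr_eq_rN (ω₂ lam β γ T : ℝ) (N : ℕ) (t : ℝ) : pairCorr ω₂ lam β γ T N t = rN ω₂ lam β γ T N t := rfl

theorem powerCov_eq_CN (ω₂ lam β γ T : ℝ) (N : ℕ) (t : ℝ) : powerCov ω₂ lam β γ T N t = CN ω₂ lam β γ T N t := rfl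

/-! ### §6.1 `0 < γ` is load-bearing for the ENGINE: at `γ = 0` the kernel is deterministic and `S_N ≡ T` -/


section GammaZero

variable {ω₂ lam β : ℝ} (hω : 0 < ω₂) (hl : 0 ≤ lam) (hβ : 0 ≤ β) (N : ℕ)

/-- Without baths the momentum noise vanishes identically. [folklore] -/
theorem chainNoise_gamma_zero (T_L T_R : ℝ) (w : WienerPair) :
    chainNoise N (Real.sqrt (2 * (pinnedChain ω₂ lam β 0).γ * T_L))
      (Real.sqrt (2 * (pinnedChain ω₂ lam β 0).γ * T_R)) w = 0 := by
  funext s i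
  simp [chainNoise]

/-- Without baths the solution map is the deterministic flow (no dependence on the driving paths).
[folklore] -/
theorem solMap_gamma_zero (T_L T_R t : ℝ) (x : PhaseSpace N) (w : WienerPair) :
    (pinnedChain ω₂ lam β 0).solMap N T_L T_R t x w = (pinnedChain ω₂ lam β 0).chainFlow N x 0 t := by
  unfold OscillatorChain.solMap
  rw [chainNoise_gamma_zero N T_L T_R w]

include hω hl hβ in
/-- **At `γ = 0` the transition kernel is the Dirac mass at the deterministic flow.** [folklore] -/
theorem transitionKernel_gamma_zero (T_L T_R : ℝ) (t : ℝ≥0) (x : PhaseSpace N) :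
    (pinnedChain ω₂ lam β 0).transitionKernel N T_L T_R t x =
      Measure.dirac ((pinnedChain ω₂ lam β 0).chainFlow N x 0 t) := by
  rw [pinnedChain_transitionKernel_apply hω hl hβ le_rfl]
  have h : (fun ω : WienerPair => (pinnedChain ω₂ lam β 0).solMap N T_L T_R (t : ℝ) x (pairPath ω)) =
      fun _ => (pinnedChain ω₂ lam β 0).chainFlow N x 0 t :=
    funext fun ω => solMap_gamma_zero N T_L T_R t x _
  rw [h, Measure.map_const, measure_univ, one_smul]

include hω hl hβ in
/-- `P_t g(x) = g(Φ_t x)` at `γ = 0`. [folklore] -/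
theorem integral_transitionKernel_gamma_zero (T_L T_R : ℝ) (t : ℝ≥0) (x : PhaseSpace N)
    (g : PhaseSpace N → ℝ) :
    ∫ y, g y ∂((pinnedChain ω₂ lam β 0).transitionKernel N T_L T_R t x) =
      g ((pinnedChain ω₂ lam β 0).chainFlow N x 0 t) := by
  rw [transitionKernel_gamma_zero hω hl hβ N, integral_dirac]

include hω hl hβ in
/-- At `γ = 0` the forecast is exact: `v_t = p_N ∘ Φ_t`. [folklore] -/
theorem fcast_gamma_zero (T t : ℝ) (z : PhaseSpace (N + 1)) :
    fcast ω₂ lam β 0 T N t z =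
      ((pinnedChain ω₂ lam β 0).chainFlow (N + 1) z 0 (t.toNNReal : ℝ)).2 (Fin.last N) := by
  unfold fcast
  rw [integral_transitionKernel_gamma_zero hω hl hβ (N + 1)]

include hω hl hβ in
/-- **`S_N(t) ≡ T` at `γ = 0`**: the forecast norm of the isolated chain is the full equilibrium
variance of `p_N`, for every `N` and `t` (Gibbs invariance of the deterministic flow, in the tree as
the `γ ≥ 0` case of the kernel invariance, plus equipartition). [folklore] -/
theorem fnorm_gamma_zero {T : ℝ} (hT : 0 < T) (t : ℝ) : fnorm ω₂ lam β 0 T N t = T := by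
  unfold fnorm
  have h1 : ∀ z : PhaseSpace (N + 1), fcast ω₂ lam β 0 T N t z ^ 2 =
      ∫ y, y.2 (Fin.last N) ^ 2 ∂((pinnedChain ω₂ lam β 0).transitionKernel (N + 1) T T t.toNNReal z) := by
    intro z
    rw [fcast_gamma_zero hω hl hβ N, integral_transitionKernel_gamma_zero hω hl hβ (N + 1)]
  simp_rw [h1]
  have hI : Integrable (fun y : PhaseSpace (N + 1) => y.2 (Fin.last N) ^ 2)
      ((pinnedChain ω₂ lam β 0).gibbsMeasure (N + 1) T) := by
    refine integrable_gibbsMeasure_of_growth hω hl hβ hT (by fun_prop) (A := 1) fun x => ?_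
    have h1 := OscillatorChain.abs_snd_apply_le_norm x (Fin.last N)
    rw [abs_pow]
    calc |x.2 (Fin.last N)| ^ 2 ≤ ‖x‖ ^ 2 := pow_le_pow_left₀ (abs_nonneg _) h1 2
      _ ≤ 1 * (1 + ‖x‖ ^ 2) ^ 2 := by nlinarith [norm_nonneg x]
  rw [pinnedChain_integral_transitionKernel_gibbsMeasure hω hl hβ le_rfl (Nat.succ_pos N) hT _ hI]
  exact gibbs_sq_momentum hω hl hβ hT (Fin.last N)

end GammaZero

/-- The engine `stub_forecastLoss` of line `two-horizons-forecast-loss` with the bath coupling allowed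
to vanish (`0 ≤ γ` in place of `0 < γ`). [folklore] -/
def ForecastLossWithoutGammaPos : Prop :=
  ∀ ω₂ lam β γ : ℝ, 0 < ω₂ → 0 < lam → 0 < β → 0 ≤ γ → ∀ T : ℝ, 0 < T →
    ∃ C α : ℝ, 2 < α ∧ ∀ (N : ℕ) (t : ℝ), 0 ≤ t → fnorm ω₂ lam β γ T N t ≤ C * (1 + t) ^ (-α)

/-- A decaying envelope cannot dominate a positive constant. [folklore] -/
theorem not_const_le_envelope {S C α : ℝ} (hS : 0 < S) (hα : 0 < α)
    (h : ∀ t : ℝ, 0 ≤ t → S ≤ C * (1 + t) ^ (-α)) : False := by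
  have hlim : Tendsto (fun t : ℝ => C * (1 + t) ^ (-α)) atTop (𝓝 0) := by
    have h1 : Tendsto (fun t : ℝ => (1 + t) ^ (-α)) atTop (𝓝 0) :=
      (tendsto_rpow_neg_atTop hα).comp (tendsto_atTop_add_const_left atTop 1 tendsto_id)
    simpa using h1.const_mul C
  have hev : ∀ᶠ t : ℝ in atTop, C * (1 + t) ^ (-α) < S := hlim.eventually (gt_mem_nhds hS)
  obtain ⟨t, ht, ht0⟩ := (hev.and (eventually_ge_atTop 0)).exists
  exact absurd (h t ht0) (not_le.2 ht)

/-- **The forecast-loss envelope is FALSE for the isolated chain** (`γ = 0`, any `ω₂ > 0`,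
`lam, β ≥ 0`, `T > 0`): `S_N(t) ≡ T` does not decay. [folklore] -/
theorem forecastLoss_false_at_gamma_zero {ω₂ lam β T : ℝ} (hω : 0 < ω₂) (hl : 0 ≤ lam) (hβ : 0 ≤ β)
    (hT : 0 < T) :
    ¬ ∃ C α : ℝ, 2 < α ∧ ∀ (N : ℕ) (t : ℝ), 0 ≤ t → fnorm ω₂ lam β 0 T N t ≤ C * (1 + t) ^ (-α) := by
  rintro ⟨C, α, hα, h⟩
  refine not_const_le_envelope hT (by linarith : 0 < α) (C := C) fun t ht => ?_
  have := h 0 t ht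
  rwa [fnorm_gamma_zero hω hl hβ 0 hT t] at this

/-- **`0 < γ` is load-bearing for the ENGINE**: `stub_forecastLoss` with `0 ≤ γ` admitted is false.
[folklore] -/
theorem forecastLossWithoutGammaPos_false : ¬ ForecastLossWithoutGammaPos := fun h =>
  forecastLoss_false_at_gamma_zero one_pos zero_le_one zero_le_one one_pos
    (h 1 1 1 0 one_pos one_pos one_pos le_rfl 1 one_pos)


/-! ### §6.2 The TRANSPORT CORE is EMPTY at the harmonic corner (Kalman): `B_N ≡ 0`, `P_N − 2r_N² ≡ 0` -/


section HarmonicVariance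

variable {ω₂ γ : ℝ} (hω : 0 < ω₂) (hγ : 0 ≤ γ) {T : ℝ} (hT : 0 < T)
include hω hγ hT

/-- **Kalman at the harmonic corner**: the conditional variance of `p_N(t)` given the initial
microstate is deterministic — `K_t p_N²(z) − (K_t p_N(z))²` does not depend on `z`. [folklore] -/
theorem harmonic_condVar_eq_const (N : ℕ) (t : ℝ) (z : PhaseSpace (N + 1)) :
    (∫ y, (y.2 (Fin.last N)) ^ 2 ∂((pinnedChain ω₂ 0 0 γ).transitionKernel (N + 1) T T t.toNNReal z)) -
        fcast ω₂ 0 0 γ T N t z ^ 2 =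
      (∫ y, (y.2 (Fin.last N)) ^ 2 ∂((pinnedChain ω₂ 0 0 γ).transitionKernel (N + 1) T T t.toNNReal 0)) -
        (∫ y, y.2 (Fin.last N) ∂((pinnedChain ω₂ 0 0 γ).transitionKernel (N + 1) T T t.toNNReal 0)) ^ 2 := by
  unfold fcast
  rw [harmonic_kernel_momentum_sq hω hγ (Nat.succ_pos N) hT t.toNNReal z (Fin.last N),
    harmonic_kernel_momentum hω hγ (Nat.succ_pos N) hT t.toNNReal z (Fin.last N)]
  ring

/-- **The variance channel of the harmonic chain is EMPTY**: `B_N(t) = Cov_{μ_T}(p_0², w_t) = 0` for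
every `N`, `t` (`w_t` constant). [folklore] -/
theorem varianceChannel_harmonic_eq_zero (N : ℕ) (t : ℝ) : varianceChannel ω₂ 0 0 γ T N t = 0 := by
  set μ := (pinnedChain ω₂ 0 0 γ).gibbsMeasure (N + 1) T with hμ
  haveI : IsProbabilityMeasure μ := pinnedChain_isProbabilityMeasure_gibbsMeasure hω le_rfl le_rfl γ (N + 1) hT
  set c : ℝ := (∫ y, (y.2 (Fin.last N)) ^ 2 ∂((pinnedChain ω₂ 0 0 γ).transitionKernel (N + 1) T T t.toNNReal 0)) -
      (∫ y, y.2 (Fin.last N) ∂((pinnedChain ω₂ 0 0 γ).transitionKernel (N + 1) T T t.toNNReal 0)) ^ 2 with hc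
  have hpt : ∀ z : PhaseSpace (N + 1),
      (∫ y, (y.2 (Fin.last N)) ^ 2 ∂((pinnedChain ω₂ 0 0 γ).transitionKernel (N + 1) T T t.toNNReal z)) =
        fcast ω₂ 0 0 γ T N t z ^ 2 + c := by
    intro z
    have h := harmonic_condVar_eq_const hω hγ hT N t z
    rw [hc]
    linarith
  -- integrability of `p_0²`, `v_t²`, `p_0² v_t²` under `μ`
  have hI_p2 : Integrable (fun z : PhaseSpace (N + 1) => z.2 0 ^ 2) μ :=
    commonPastBound_integrable_momentum_pow_gibbsMeasure hω le_rfl le_rfl γ hT 0 2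
  have hI_f2 : Integrable (fun z => fcast ω₂ 0 0 γ T N t z ^ 2) μ :=
    (commonPastBound_fnorm_le hω le_rfl le_rfl hγ hT N t).1
  have hI_p2f2 : Integrable (fun z : PhaseSpace (N + 1) => z.2 0 ^ 2 * fcast ω₂ 0 0 γ T N t z ^ 2) μ := by
    have hp4 : Integrable (fun z : PhaseSpace (N + 1) => (z.2 0 ^ 2) ^ 2) μ := by
      have h := commonPastBound_integrable_momentum_pow_gibbsMeasure hω le_rfl le_rfl γ hT (0 : Fin (N + 1)) 4
      refine h.congr (Eventually.of_forall fun z => ?_)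
      simp only
      ring
    have hf4 : Integrable (fun z => (fcast ω₂ 0 0 γ T N t z ^ 2) ^ 2) μ := by
      have h := (commonPastBound_fcast_even_moment hω le_rfl le_rfl hγ hT N t 2).1
      refine h.congr (Eventually.of_forall fun z => ?_)
      simp only
      ring
    have hfm : Measurable fun z => fcast ω₂ 0 0 γ T N t z :=
      commonPastBound_measurable_fcast_right hω le_rfl le_rfl hγ (T := T) N t
    exact lightCone_integrable_mul_of_sq (by fun_prop : Measurable fun z : PhaseSpace (N + 1) => z.2 0 ^ 2).aestronglyMeasurable
      (hfm.pow_const 2).aestronglyMeasurable hp4 hf4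
  unfold varianceChannel powerCov commonPast
  simp_rw [hpt]
  have e1 : (fun z : PhaseSpace (N + 1) => z.2 0 ^ 2 * (fcast ω₂ 0 0 γ T N t z ^ 2 + c)) =
      fun z => z.2 0 ^ 2 * fcast ω₂ 0 0 γ T N t z ^ 2 + c * z.2 0 ^ 2 := funext fun z => by ring
  rw [e1, integral_add hI_p2f2 (hI_p2.const_mul c), integral_const_mul,
    integral_add hI_f2 (integrable_const c), integral_const, probReal_univ, one_smul]
  ring

/-- Hence the transport sequence of `stub_varianceLimit` vanishes identically at the harmonic corner.
[folklore] -/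
theorem varianceSeq_harmonic_eq_zero (N : ℕ) :
    (N : ℝ) * (γ ^ 2 / T ^ 2) * ∫ t in Ioi (0 : ℝ), varianceChannel ω₂ 0 0 γ T N t = 0 := by
  simp [varianceChannel_harmonic_eq_zero hω hγ hT]

/-- **`stub_varianceLimit` is FALSE at the harmonic corner**: no `κ > 0` is the limit of the
identically vanishing transport sequence. So `0 < lam`, `0 < β` are load-bearing for the TRANSPORT
CORE of the line, and the crux's entire harmonic obstruction (`HarmonicWick.not_crux_at_harmonic`)
sits in this stub. [folklore] -/
theorem varianceLimit_false_harmonic :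
    ¬ ∃ κ : ℝ, 0 < κ ∧ Tendsto (fun N : ℕ => (N : ℝ) * (γ ^ 2 / T ^ 2) *
        ∫ t in Ioi (0 : ℝ), varianceChannel ω₂ 0 0 γ T N t) atTop (𝓝 κ) := by
  rintro ⟨κ, hκ, hlim⟩
  have h0 : Tendsto (fun N : ℕ => (N : ℝ) * (γ ^ 2 / T ^ 2) *
      ∫ t in Ioi (0 : ℝ), varianceChannel ω₂ 0 0 γ T N t) atTop (𝓝 0) := by
    have : (fun N : ℕ => (N : ℝ) * (γ ^ 2 / T ^ 2) * ∫ t in Ioi (0 : ℝ), varianceChannel ω₂ 0 0 γ T N t) =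
        fun _ => 0 := funext (varianceSeq_harmonic_eq_zero hω hγ hT)
    rw [this]
    exact tendsto_const_nhds
  exact (lt_irrefl (0 : ℝ)) ((tendsto_nhds_unique hlim h0) ▸ hκ)

/-- The common-past part EQUALS the power covariance at the harmonic corner (`B_N ≡ 0`), so by the
landed Wick identity the mean-channel integrand vanishes identically too: `P_N − 2 r_N² ≡ 0`.
[folklore] -/
theorem commonPast_harmonic_eq (N : ℕ) (t : ℝ) :
    commonPast ω₂ 0 0 γ T N t = powerCov ω₂ 0 0 γ T N t := by
  have h := varianceChannel_harmonic_eq_zero hω hγ hT N t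
  unfold varianceChannel at h
  linarith

theorem meanChannel_integrand_harmonic_eq_zero (N : ℕ) (t : ℝ) :
    commonPast ω₂ 0 0 γ T N t - 2 * (pairCorr ω₂ 0 0 γ T N t) ^ 2 = 0 := by
  rw [commonPast_harmonic_eq hω hγ hT]
  have h := Summit.AtomisticToContinuum.FouriersLaw.Theorems.IncoherentChannel.Negative.HarmonicWick.harmonic_wick hω hγ hT N t
  simp only [powerCov, pairCorr, fcast] at h ⊢
  linarith

end HarmonicVariance

/-- The transport core `stub_varianceLimit` of line `two-horizons-forecast-loss` with anharmonicity
allowed to vanish (`0 ≤ lam`, `0 ≤ β`). [folklore] -/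
def VarianceLimitWithoutAnharmonicity : Prop :=
  ∀ ω₂ lam β γ : ℝ, 0 < ω₂ → 0 ≤ lam → 0 ≤ β → 0 < γ → ∀ T : ℝ, 0 < T →
    ∃ κ : ℝ, 0 < κ ∧ Tendsto (fun N : ℕ => (N : ℝ) * (γ ^ 2 / T ^ 2) *
      ∫ t in Ioi (0 : ℝ), varianceChannel ω₂ lam β γ T N t) atTop (𝓝 κ)

/-- **`0 < lam ∧ 0 < β` admitted-away kills the transport core.** [folklore] -/
theorem varianceLimitWithoutAnharmonicity_false : ¬ VarianceLimitWithoutAnharmonicity := fun h =>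
  varianceLimit_false_harmonic one_pos zero_le_one one_pos (h 1 0 0 1 one_pos le_rfl le_rfl one_pos 1 one_pos)


/-! ### §6.3 Amplitude scaling of the line objects: both open stubs are their `T = 1` slices -/


/-- The forecast-loss envelope of `stub_forecastLoss` AT ONE PARAMETER POINT. [folklore] -/
def ForecastEnvelopeAt (ω₂ lam β γ T : ℝ) : Prop :=
  ∃ C α : ℝ, 2 < α ∧ ∀ (N : ℕ) (t : ℝ), 0 ≤ t → fnorm ω₂ lam β γ T N t ≤ C * (1 + t) ^ (-α)

/-- The transport limit of `stub_varianceLimit` AT ONE PARAMETER POINT. [folklore] -/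
def VarianceLimitAt (ω₂ lam β γ T : ℝ) : Prop :=
  ∃ κ : ℝ, 0 < κ ∧ Tendsto (fun N : ℕ => (N : ℝ) * (γ ^ 2 / T ^ 2) *
    ∫ t in Ioi (0 : ℝ), varianceChannel ω₂ lam β γ T N t) atTop (𝓝 κ)

section LineScaling

variable {ω₂ lam β γ : ℝ} (hω : 0 < ω₂) (hl : 0 ≤ lam) (hβ : 0 ≤ β) (hγ : 0 ≤ γ)
include hω hl hβ hγ

/-- The mean forecast is an amplitude: `v_t(s•x; lam,β,s²T) = s · v_t(x; lam s²,β s²,T)`. [folklore] -/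
theorem fcast_smul {s : ℝ} (hs : 0 < s) (T : ℝ) (N : ℕ) (t : ℝ) (x : PhaseSpace (N + 1)) :
    fcast ω₂ lam β γ (s ^ 2 * T) N t (s • x) = s * fcast ω₂ (lam * s ^ 2) (β * s ^ 2) γ T N t x := by
  unfold fcast
  rw [integral_transitionKernel_smul hω hl hβ hγ (N + 1) hs T T _ x]
  simp only [Prod.smul_snd, Pi.smul_apply, smul_eq_mul]
  exact integral_const_mul s _

/-- The forecast norm is an energy: `S_N(t; lam,β,s²T) = s² · S_N(t; lam s²,β s²,T)`. [folklore] -/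
theorem fnorm_smul {s : ℝ} (hs : 0 < s) (T : ℝ) (N : ℕ) (t : ℝ) :
    fnorm ω₂ lam β γ (s ^ 2 * T) N t = s ^ 2 * fnorm ω₂ (lam * s ^ 2) (β * s ^ 2) γ T N t := by
  unfold fnorm
  rw [integral_gibbsMeasure_smul (N + 1) hs.ne' T, ← integral_const_mul]
  refine integral_congr_ae (Eventually.of_forall fun x => ?_)
  simp only []
  rw [fcast_smul hω hl hβ hγ hs]
  ring

/-- `r_N ↦ s² r_N` (restated over the route vocabulary). [folklore] -/
theorem pairCorr_smul {s : ℝ} (hs : 0 < s) (T : ℝ) (N : ℕ) (t : ℝ) :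
    pairCorr ω₂ lam β γ (s ^ 2 * T) N t = s ^ 2 * pairCorr ω₂ (lam * s ^ 2) (β * s ^ 2) γ T N t := by
  simp only [pairCorr, fcast]
  exact rN_smul hω hl hβ hγ hs T N t

/-- `C_N ↦ s⁴ C_N` (restated over the route vocabulary). [folklore] -/
theorem powerCov_smul {s : ℝ} (hs : 0 < s) (T : ℝ) (N : ℕ) (t : ℝ) :
    powerCov ω₂ lam β γ (s ^ 2 * T) N t = s ^ 4 * powerCov ω₂ (lam * s ^ 2) (β * s ^ 2) γ T N t := by
  simp only [powerCov]
  exact CN_smul hω hl hβ hγ hs T N t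

/-- `P_N ↦ s⁴ P_N`. [folklore] -/
theorem commonPast_smul {s : ℝ} (hs : 0 < s) (T : ℝ) (N : ℕ) (t : ℝ) :
    commonPast ω₂ lam β γ (s ^ 2 * T) N t = s ^ 4 * commonPast ω₂ (lam * s ^ 2) (β * s ^ 2) γ T N t := by
  unfold commonPast
  rw [integral_gibbsMeasure_smul (N + 1) hs.ne' T, integral_gibbsMeasure_smul (N + 1) hs.ne' T,
    integral_gibbsMeasure_smul (N + 1) hs.ne' T]
  simp_rw [fcast_smul hω hl hβ hγ hs]
  simp only [Prod.smul_snd, Pi.smul_apply, smul_eq_mul]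
  have e1 : (fun x : PhaseSpace (N + 1) => (s * x.2 0) ^ 2 * (s * fcast ω₂ (lam * s ^ 2) (β * s ^ 2) γ T N t x) ^ 2) =
      fun x => s ^ 4 * (x.2 0 ^ 2 * fcast ω₂ (lam * s ^ 2) (β * s ^ 2) γ T N t x ^ 2) := funext fun x => by ring
  have e2 : (fun x : PhaseSpace (N + 1) => (s * x.2 0) ^ 2) = fun x => s ^ 2 * x.2 0 ^ 2 :=
    funext fun x => by ring
  have e3 : (fun x : PhaseSpace (N + 1) => (s * fcast ω₂ (lam * s ^ 2) (β * s ^ 2) γ T N t x) ^ 2) =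
      fun x => s ^ 2 * fcast ω₂ (lam * s ^ 2) (β * s ^ 2) γ T N t x ^ 2 := funext fun x => by ring
  rw [e1, e2, e3, integral_const_mul, integral_const_mul, integral_const_mul]
  ring

/-- `B_N ↦ s⁴ B_N`. [folklore] -/
theorem varianceChannel_smul {s : ℝ} (hs : 0 < s) (T : ℝ) (N : ℕ) (t : ℝ) :
    varianceChannel ω₂ lam β γ (s ^ 2 * T) N t =
      s ^ 4 * varianceChannel ω₂ (lam * s ^ 2) (β * s ^ 2) γ T N t := by
  unfold varianceChannel
  rw [powerCov_smul hω hl hβ hγ hs, commonPast_smul hω hl hβ hγ hs]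
  ring

/-- **The transport sequence of `stub_varianceLimit` is scale-INVARIANT** (the prefactor `γ²/T²`
absorbs the `s⁴`). [folklore] -/
theorem varianceSeq_smul {s : ℝ} (hs : 0 < s) (T : ℝ) (N : ℕ) :
    (N : ℝ) * (γ ^ 2 / (s ^ 2 * T) ^ 2) * ∫ t in Ioi (0 : ℝ), varianceChannel ω₂ lam β γ (s ^ 2 * T) N t =
      (N : ℝ) * (γ ^ 2 / T ^ 2) * ∫ t in Ioi (0 : ℝ), varianceChannel ω₂ (lam * s ^ 2) (β * s ^ 2) γ T N t := by
  simp_rw [varianceChannel_smul hω hl hβ hγ hs T N]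
  rw [integral_const_mul]
  have hs4 : s ^ 4 ≠ 0 := pow_ne_zero 4 hs.ne'
  rw [show (s ^ 2 * T) ^ 2 = s ^ 4 * T ^ 2 by ring, div_mul_eq_div_div_swap]
  rw [show (N : ℝ) * (γ ^ 2 / T ^ 2 / s ^ 4) * (s ^ 4 * ∫ t in Ioi (0 : ℝ), varianceChannel ω₂ (lam * s ^ 2) (β * s ^ 2) γ T N t) =
      (N : ℝ) * (γ ^ 2 / T ^ 2 / s ^ 4 * s ^ 4) * ∫ t in Ioi (0 : ℝ), varianceChannel ω₂ (lam * s ^ 2) (β * s ^ 2) γ T N t by ring,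
    div_mul_cancel₀ _ hs4]

/-- **Temperature enters the forecast norm only through the effective couplings**:
`S_N(t; lam,β,T) = T · S_N(t; lam·T, β·T, 1)` (`T > 0`). [folklore] -/
theorem fnorm_eq_effective {T : ℝ} (hT : 0 < T) (N : ℕ) (t : ℝ) :
    fnorm ω₂ lam β γ T N t = T * fnorm ω₂ (lam * T) (β * T) γ 1 N t := by
  have hs : 0 < Real.sqrt T := Real.sqrt_pos.2 hT
  have hT' : Real.sqrt T ^ 2 = T := Real.sq_sqrt hT.le
  have h := fnorm_smul (ω₂ := ω₂) (lam := lam) (β := β) (γ := γ) hω hl hβ hγ hs 1 N t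
  rwa [mul_one, hT'] at h

/-- The transport sequence depends on `(lam·T, β·T)` only. [folklore] -/
theorem varianceSeq_eq_effective {T : ℝ} (hT : 0 < T) (N : ℕ) :
    (N : ℝ) * (γ ^ 2 / T ^ 2) * ∫ t in Ioi (0 : ℝ), varianceChannel ω₂ lam β γ T N t =
      (N : ℝ) * (γ ^ 2 / (1 : ℝ) ^ 2) * ∫ t in Ioi (0 : ℝ), varianceChannel ω₂ (lam * T) (β * T) γ 1 N t := by
  have hs : 0 < Real.sqrt T := Real.sqrt_pos.2 hT
  have hT' : Real.sqrt T ^ 2 = T := Real.sq_sqrt hT.le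
  have h := varianceSeq_smul (ω₂ := ω₂) (lam := lam) (β := β) (γ := γ) hω hl hβ hγ hs 1 N
  rwa [mul_one, hT'] at h

/-- **The envelope at `T` is the envelope at unit temperature with effective couplings**
(`C ↦ C/T`). [folklore] -/
theorem forecastEnvelopeAt_iff_effective {T : ℝ} (hT : 0 < T) :
    ForecastEnvelopeAt ω₂ lam β γ T ↔ ForecastEnvelopeAt ω₂ (lam * T) (β * T) γ 1 := by
  constructor
  · rintro ⟨C, α, hα, h⟩
    refine ⟨C / T, α, hα, fun N t ht => ?_⟩
    have h1 := h N t ht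
    rw [fnorm_eq_effective hω hl hβ hγ hT] at h1
    rw [div_mul_eq_mul_div, le_div_iff₀ hT]
    linarith
  · rintro ⟨C, α, hα, h⟩
    refine ⟨T * C, α, hα, fun N t ht => ?_⟩
    rw [fnorm_eq_effective hω hl hβ hγ hT, mul_assoc]
    exact mul_le_mul_of_nonneg_left (h N t ht) hT.le

/-- **The transport limit at `T` is the transport limit at unit temperature with effective
couplings** (same `κ`). [folklore] -/
theorem varianceLimitAt_iff_effective {T : ℝ} (hT : 0 < T) :
    VarianceLimitAt ω₂ lam β γ T ↔ VarianceLimitAt ω₂ (lam * T) (β * T) γ 1 := by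
  unfold VarianceLimitAt
  rw [show (fun N : ℕ => (N : ℝ) * (γ ^ 2 / T ^ 2) * ∫ t in Ioi (0 : ℝ), varianceChannel ω₂ lam β γ T N t) =
      fun N : ℕ => (N : ℝ) * (γ ^ 2 / (1 : ℝ) ^ 2) * ∫ t in Ioi (0 : ℝ), varianceChannel ω₂ (lam * T) (β * T) γ 1 N t
    from funext (varianceSeq_eq_effective hω hl hβ hγ hT)]

end LineScaling

/-- **`stub_forecastLoss` is equivalent to its `T = 1` slice** (its body is
`∀ params > 0, ∀ T > 0, ForecastEnvelopeAt ω₂ lam β γ T` by `Iff.rfl`). [folklore] -/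
theorem forecastLoss_iff_unit_temperature :
    (∀ ω₂ lam β γ : ℝ, 0 < ω₂ → 0 < lam → 0 < β → 0 < γ → ∀ T : ℝ, 0 < T → ForecastEnvelopeAt ω₂ lam β γ T) ↔
      ∀ ω₂ lam β γ : ℝ, 0 < ω₂ → 0 < lam → 0 < β → 0 < γ → ForecastEnvelopeAt ω₂ lam β γ 1 := by
  constructor
  · intro h ω₂ lam β γ hω hl hβ hγ
    exact h ω₂ lam β γ hω hl hβ hγ 1 one_pos
  · intro h ω₂ lam β γ hω hl hβ hγ T hT
    rw [forecastEnvelopeAt_iff_effective hω hl.le hβ.le hγ.le hT]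
    exact h ω₂ (lam * T) (β * T) γ hω (by positivity) (by positivity) hγ

/-- **`stub_varianceLimit` is equivalent to its `T = 1` slice.** [folklore] -/
theorem varianceLimit_iff_unit_temperature :
    (∀ ω₂ lam β γ : ℝ, 0 < ω₂ → 0 < lam → 0 < β → 0 < γ → ∀ T : ℝ, 0 < T → VarianceLimitAt ω₂ lam β γ T) ↔
      ∀ ω₂ lam β γ : ℝ, 0 < ω₂ → 0 < lam → 0 < β → 0 < γ → VarianceLimitAt ω₂ lam β γ 1 := by
  constructor
  · intro h ω₂ lam β γ hω hl hβ hγ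
    exact h ω₂ lam β γ hω hl hβ hγ 1 one_pos
  · intro h ω₂ lam β γ hω hl hβ hγ T hT
    rw [varianceLimitAt_iff_effective hω hl.le hβ.le hγ.le hT]
    exact h ω₂ (lam * T) (β * T) γ hω (by positivity) (by positivity) hγ


/-! ### §6.4 Why the line resists; what the engine must deliver on ONE bath momentum (no coherent echo) -/


/-! ## Resistance: the residual content of the line is the conjunct -/

/-- **With `NessUnique` and `BoundaryKubo` now THEOREMS, coherent dephasing alone makes the crux
EQUIVALENT to the sub-problem conjunct.** [folklore] -/
theorem incoherentChannel_iff_fouriersLaw_of_coherentDephasing (hA : CoherentDephasing) :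
    IncoherentChannel ↔ _root_.FouriersLaw :=
  incoherentChannel_iff_fouriersLaw NessUnique_holds boundaryKubo_proof hA

/-- **Once the engine `stub_forecastLoss` is proved, `IncoherentChannel ↔ FouriersLaw`**
(`coherentDephasing_of_forecastLoss` is landed). So a disproof of the crux along this line is a
disproof of Fourier's law for the pinned anharmonic chain, and the only line-specific disprover
target is the engine itself. [folklore] -/
theorem incoherentChannel_iff_fouriersLaw_of_forecastLoss
    (h₁ : ∀ ω₂ lam β γ : ℝ, 0 < ω₂ → 0 < lam → 0 < β → 0 < γ → ∀ T : ℝ, 0 < T →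
      ∃ C α : ℝ, 2 < α ∧ ∀ (N : ℕ) (t : ℝ), 0 ≤ t → fnorm ω₂ lam β γ T N t ≤ C * (1 + t) ^ (-α)) :
    IncoherentChannel ↔ _root_.FouriersLaw :=
  incoherentChannel_iff_fouriersLaw_of_coherentDephasing (coherentDephasing_of_forecastLoss h₁)

/-- **Modulo the engine, the transport core `stub_varianceLimit` IS the conjunct** (both are the
Kubo-form Fourier law: `fouriersLaw_iff_kuboForm` + `powerCovLimit_iff_varianceLimit_of_forecastLoss`,
all landed by the lead; this is the statement the continuation lead registered as
`varianceLimit_iff_fouriersLaw_of_forecastLoss`). [folklore] -/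
theorem varianceLimit_iff_fouriersLaw_of_forecastLoss'
    (h₁ : ∀ ω₂ lam β γ : ℝ, 0 < ω₂ → 0 < lam → 0 < β → 0 < γ → ∀ T : ℝ, 0 < T →
      ∃ C α : ℝ, 2 < α ∧ ∀ (N : ℕ) (t : ℝ), 0 ≤ t → fnorm ω₂ lam β γ T N t ≤ C * (1 + t) ^ (-α)) :
    (∀ ω₂ lam β γ : ℝ, 0 < ω₂ → 0 < lam → 0 < β → 0 < γ → ∀ T : ℝ, 0 < T →
      ∃ κ : ℝ, 0 < κ ∧ Tendsto (fun N : ℕ => (N : ℝ) * (γ ^ 2 / T ^ 2) *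
        ∫ t in Ioi (0 : ℝ), varianceChannel ω₂ lam β γ T N t) atTop (𝓝 κ)) ↔ _root_.FouriersLaw := by
  rw [fouriersLaw_iff_kuboForm]
  constructor
  · intro h ω₂ lam β γ hω hl hβ hγ T hT
    obtain ⟨κ, hκ, hlim⟩ := h ω₂ lam β γ hω hl hβ hγ T hT
    exact ⟨κ, hκ, (powerCovLimit_iff_varianceLimit_of_forecastLoss h₁ hω hl hβ hγ hT κ).2 hlim⟩
  · intro h ω₂ lam β γ hω hl hβ hγ T hT
    obtain ⟨κ, hκ, hlim⟩ := h ω₂ lam β γ hω hl hβ hγ T hT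
    exact ⟨κ, hκ, (powerCovLimit_iff_varianceLimit_of_forecastLoss h₁ hω hl hβ hγ hT κ).1 hlim⟩

/-! ## What the engine must deliver on ONE bath momentum: no coherent echo -/

section Echo

variable {ω₂ lam β γ T : ℝ} (hω : 0 < ω₂) (hl : 0 ≤ lam) (hβ : 0 ≤ β) (hγ : 0 ≤ γ) (hT : 0 < T)

/-- The END-MOMENTUM AUTOCORRELATION `a_N(t) = ⟨p_N, K_t p_N⟩_{μ_T}` of the thermostatted site.
[folklore] -/
def endAutocorr (ω₂ lam β γ T : ℝ) (N : ℕ) (t : ℝ) : ℝ :=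
  ∫ z, z.2 (Fin.last N) * fcast ω₂ lam β γ T N t z ∂((pinnedChain ω₂ lam β γ).gibbsMeasure (N + 1) T)

include hω hl hβ hγ hT in
/-- **`a_N(t)² ≤ T · S_N(t)`** (Cauchy–Schwarz in `L²(μ_T)`, `‖p_N‖² = T`): the forecast norm
dominates the squared autocorrelation of the bath momentum itself. [folklore] -/
theorem endAutocorr_sq_le (N : ℕ) (t : ℝ) :
    endAutocorr ω₂ lam β γ T N t ^ 2 ≤ T * fnorm ω₂ lam β γ T N t := by
  set μ₀ := (pinnedChain ω₂ lam β γ).gibbsMeasure (N + 1) T with hμ₀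
  set i : Fin (N + 1) := Fin.last N with hi
  set v : PhaseSpace (N + 1) → ℝ := fun z => fcast ω₂ lam β γ T N t z with hv
  have hvm : Measurable v := commonPastBound_measurable_fcast_right hω hl hβ hγ N t
  have hI1 : Integrable (fun z : PhaseSpace (N + 1) => z.2 i ^ 2) μ₀ :=
    commonPastBound_integrable_momentum_pow_gibbsMeasure hω hl hβ γ hT i 2
  have hI2 : Integrable (fun z => v z ^ 2) μ₀ := (commonPastBound_fnorm_le hω hl hβ hγ hT N t).1
  have hI3 : Integrable (fun z : PhaseSpace (N + 1) => z.2 i * v z) μ₀ := by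
    refine ((hI1.add hI2).div_const 2).mono'
      (((measurable_pi_apply i).comp measurable_snd).mul hvm).aestronglyMeasurable
      (Eventually.of_forall fun z => ?_)
    rw [Real.norm_eq_abs, abs_mul]
    have := two_mul_le_add_sq |z.2 i| |v z|
    rw [sq_abs, sq_abs] at this
    simp only [Pi.add_apply]
    linarith
  have hT1 : ∫ z : PhaseSpace (N + 1), z.2 i ^ 2 ∂μ₀ = T := by
    have h := commonPastBound_gibbs_even_moment hω hl hβ γ hT i 1
    simpa using h
  set r := endAutocorr ω₂ lam β γ T N t with hr
  set S := fnorm ω₂ lam β γ T N t with hS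
  have hr' : r = ∫ z, z.2 i * v z ∂μ₀ := rfl
  have hS' : S = ∫ z, v z ^ 2 ∂μ₀ := rfl
  have key : ∀ a : ℝ, 0 ≤ a ^ 2 * T - 2 * a * r + S := by
    intro a
    have hnn : 0 ≤ ∫ z, (a * z.2 i - v z) ^ 2 ∂μ₀ := integral_nonneg fun z => sq_nonneg _
    have e : (fun z : PhaseSpace (N + 1) => (a * z.2 i - v z) ^ 2) =
        fun z => (a ^ 2 * z.2 i ^ 2 - 2 * a * (z.2 i * v z)) + v z ^ 2 := by
      funext z; ring
    have hA : Integrable (fun z : PhaseSpace (N + 1) => a ^ 2 * z.2 i ^ 2 - 2 * a * (z.2 i * v z)) μ₀ :=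
      (hI1.const_mul _).sub (hI3.const_mul _)
    rw [e, integral_add hA hI2, integral_sub (hI1.const_mul _) (hI3.const_mul _), integral_const_mul,
      integral_const_mul, hT1, ← hr', ← hS'] at hnn
    exact hnn
  have h := key (r / T)
  have e : (r / T) ^ 2 * T - 2 * (r / T) * r + S = S - r ^ 2 / T := by
    field_simp
    ring
  rw [e, sub_nonneg, div_le_iff₀ hT] at h
  linarith

include hω hl hβ hγ hT in
/-- `S_N(0) = T`: at time zero the forecast is `p_N` itself (`K_0 = id`), so NO envelope constant
below `T` is possible and the decay asserted by the engine is entirely dynamical. [folklore] -/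
theorem fnorm_zero (N : ℕ) : fnorm ω₂ lam β γ T N 0 = T := by
  have hK : ∀ z : PhaseSpace (N + 1), fcast ω₂ lam β γ T N 0 z = z.2 (Fin.last N) := by
    intro z
    unfold fcast
    rw [Real.toNNReal_zero, pinnedChain_transitionKernel_zero hω hl hβ hγ, ProbabilityTheory.Kernel.id_apply,
      integral_dirac]
  unfold fnorm
  simp_rw [hK]
  have h := commonPastBound_gibbs_even_moment hω hl hβ γ hT (Fin.last N : Fin (N + 1)) 1
  simpa using h

include hω hl hβ hγ hT in
/-- Any envelope constant of `stub_forecastLoss` satisfies `T ≤ C`. [folklore] -/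
theorem envelope_const_ge {C α : ℝ}
    (h : ∀ (N : ℕ) (t : ℝ), 0 ≤ t → fnorm ω₂ lam β γ T N t ≤ C * (1 + t) ^ (-α)) : T ≤ C := by
  have h0 := h 0 0 le_rfl
  rw [fnorm_zero hω hl hβ hγ hT 0] at h0
  simpa using h0

include hω hl hβ hγ hT in
/-- **NO COHERENT ECHO**: the engine forces an `N`-uniform, integrable-with-margin envelope on the
squared autocorrelation of the bath momentum, `a_N(t)² ≤ T·C·(1+t)^{-α}` for all `N`, `t ≥ 0` — an
equilibrium two-time function of ONE thermostatted coordinate, directly measurable; at the harmonic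
corner the reflected wave returning from the far bath at `t ≈ 2N/v` is such an echo. [folklore] -/
theorem endAutocorr_envelope_of_forecastEnvelope {C α : ℝ}
    (h : ∀ (N : ℕ) (t : ℝ), 0 ≤ t → fnorm ω₂ lam β γ T N t ≤ C * (1 + t) ^ (-α)) (N : ℕ) {t : ℝ}
    (ht : 0 ≤ t) : endAutocorr ω₂ lam β γ T N t ^ 2 ≤ T * C * (1 + t) ^ (-α) := by
  calc endAutocorr ω₂ lam β γ T N t ^ 2 ≤ T * fnorm ω₂ lam β γ T N t := endAutocorr_sq_le hω hl hβ hγ hT N t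
    _ ≤ T * (C * (1 + t) ^ (-α)) := mul_le_mul_of_nonneg_left (h N t ht) hT.le
    _ = T * C * (1 + t) ^ (-α) := by ring

end Echo


end Summit.AtomisticToContinuum.FouriersLaw.Cruxes.IncoherentChannel.Disproof
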